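import Literature.NumberTheory.LFunctions.AlternativeHypothesisAtomWindows
import Literature.NumberTheory.LFunctions.MontgomeryTheoremTestFunctions
import Literature.NumberTheory.LFunctions.RudnickSarnakPairSmoothed
import Literature.NumberTheory.LFunctions.AlternativeHypothesisLemma6Proofs
import HarnessLib

/-!
# BGSTB 2025, Theorem 3: the assembly of the window asymptotics (composition layer)

Topic `Literature/NumberTheory/LFunctions` (namespace `Literature.NumberTheory.LFunctions.AH.Thm3`).
Theorems only: no definition, no named fact. LABEL (cell rh-crit, corpus C5): NOT RH-BEARING — composition
plumbing whose inputs are RH- and AH-Pairs-conditional window statements of an unrefereed preprint; nothing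
here bears on the truth of RH. OURS: the composition modulo NAMED window inputs (hypotheses `hWii`, … below);
RH and AH-Pairs are the printed antecedents of those inputs and do not appear here.

Baluyot–Goldston–Suriajaya–Turnage-Butterbaugh 2025 (arXiv:2508.10857), §7, proof of Theorem 3
(TeX l.1058–1090): "In this proof we are taking `T → ∞` and then making `M` large and `λ` appropriately
small in Lemma 6." … "Next, by Lemma 6 (ii) for an interval `[a−λ,a+λ] ⊂ (N+λ,N+1−λ)` for `N ∈ ℤ`, we
have `∫_{a−λ}^{a+λ} F(α) dα ∼ ∫_{a−λ}^{a+λ} s(α) dα ∼ ∫_{a−λ}^{a+λ} 𝓕(α) dα`. Now suppose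
`[a,b] ⊂ (N+λ,N+1−λ)` for `N ∈ ℤ`. For a step function `r(α)` in this interval, we pick `λ` smaller than
the mesh of this step function and can write `r` as a step function over intervals of the form
`(c_j−λ, c_j+λ)`, and conclude `∫_a^b F(α) r(α) dα ∼ ∫_a^b s(α) r(α) dα ∼ ∫_a^b 𝓕(α) r(α) dα`. Thus by
approximation this also holds for any Riemann integrable function `g(α)`. Now for a general interval
`[a,b]`, `a,b ∉ ℤ`, we have writing `[a] = N−1`, `[b] = M`, and taking `λ < min(‖a‖,‖b‖)`,
`∫_a^b F g = ∫_a^{N−λ} Fg + ∑_{N≤j≤M} ∫_{j−λ}^{j+λ} Fg + ∑_{N≤j≤M−1} ∫_{j+λ}^{j+1−λ} Fg + ∫_{M+λ}^b Fg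
∼ ∫_a^b 𝓕(α) g(α) dα`, since each integral in the middle step has been evaluated above to give the
right-hand side. If `a` or `b` are equal to `0` or `±1` we use the one-sided delta functions to obtain
the same result."

This module is the COMPOSITION layer of that argument (our gloss, not a quotation): it takes the window
asymptotics as explicit hypotheses, in `M`-free LIMIT FORM along `T → ∞` — e.g. (W-ii): for every `K`
and every `ε > 0` there is `λ₀ > 0` such that for every `0 < λ ≤ λ₀`, for all large `T`, every window of
half-width `λ` centred at `α`, `|α| ≤ K`, at distance `≥ 2λ` from the integers has
`|(1/2λ) ∫_{α−λ}^{α+λ} F(β,T) dβ − s(α)| ≤ ε` — and proves the corresponding conjuncts of the typed claim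
`bgstb2025_theorem3` (`AlternativeHypothesisFormFactor.lean`) in its rendering
`Tendsto (fun T ↦ ∫_a^b F(α,T) g(α) dα − AH.calFIntegral (P₀ T) a b g) atTop (𝓝 0)`. The limit-form
hypotheses are what the printed recipe "taking `T → ∞` and then making `M` large and `λ` appropriately
small" extracts from Lemma 6 under AH-Pairs at every level with `M`-uniform constants (cell row «U»);
that extraction is not part of this file. The integer-free step uses the tree's window ⇒ test-function
layer (`AH.tendsto_intervalIntegral_of_window`, `AH.tendsto_intervalIntegral_mul_of_tendsto_intervalIntegral`,
`AlternativeHypothesisWindowToTestFunction.lean`); the atoms use the tree's atom-window inequality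
(`AH.abs_intervalIntegral_mul_sub_le`, `AlternativeHypothesisAtomWindows.lean`).

* `AH.Thm3.continuous_triangleWave` — the sawtooth `s` is continuous (it is the norm on `ℝ/2ℤ`);
* `AH.Thm3.calFIntegral_eq_of_intFree` — on an interval `[a,b]` containing no integer,
  `∫_a^b 𝓕 g = ∫_a^b s g` (no mass of `𝓕` meets `[a,b]`);
* `AH.Thm3.calFIntegral_add` — additivity `∫_a^c 𝓕 g + ∫_c^b 𝓕 g = ∫_a^b 𝓕 g` at every splitting point
  `c ∉ ℤ ∖ {−1,0,1}` (the typed `AH.calFIntegral` assigns its one-sided masses at `0, ±1` consistently);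
* `AH.Thm3.tendsto_sub_calFIntegral_add` — the `o(1)` statements on `[a,c]` and `[c,b]` give the one on
  `[a,b]`;
* `AH.Thm3.tendsto_sub_calFIntegral_of_intFree` — **the integer-free-interval conjunct of Theorem 3 from
  (W-ii)**: for `[a,b]` free of integers and `g` bounded and a.e.-continuous within `[a,b]`,
  `∫_a^b F(α,T) g(α) dα − AH.calFIntegral (P₀ T) a b g → 0` for every `P₀`;
* `AH.Thm3.tendsto_sub_of_atom` — **one interior atom, two-sided**: on `[u,v]` whose only integer point is
  `n`, from (W-ii), the window-mass input at `n` in limit form (`|∫_{n−λ}^{n+λ} F(β,T) dβ − c(T)| ≤ ε` for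
  all small `λ`, eventually in `T`, `c` eventually bounded) and continuity of `g` at `n`:
  `∫_u^v F g − (∫_u^v s g + c(T) g(n)) → 0` (uses the tree's atom-window inequality
  `AH.abs_intervalIntegral_mul_sub_le`, `AlternativeHypothesisAtomWindows.lean`);
  `AH.Thm3.tendsto_sub_of_atom_right` / `_left` — the one-sided versions at an endpoint atom;
* `AH.Thm3.calFIntegral_eq_of_single_even` / `_odd` / `_of_right_one` / `_of_left_negOne` — `∫ 𝓕 g` on an
  interval meeting exactly one mass of `𝓕` (even atom `2L ≠ 0`: `g(2L)`; odd atom `|K| ≥ 3`: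
  `2(P_0−1) g(K)`; `[1,v]`: `2(P_0−1) g(1)`; `[u,−1]`: `2(P_0−1) g(−1)`);
* `AH.Thm3.exists_abs_binDensity_le` — (W-P) is a THEOREM: under RH, `P_0(T) = AH.binDensity 0 T M δ` is
  eventually bounded (pair-window count);
* `AH.Thm3.continuousAt_of_isLipschitzAt`, `…continuousWithinAt_Ici_of_isRightLipschitzAt`,
  `…continuousWithinAt_Iic_of_isLeftLipschitzAt` — the printed pointwise Lipschitz hypotheses imply the
  continuity our atom lemmas use;
* `AH.Thm3.tendsto_sub_calFIntegral_of_even` / `_of_odd` / `_of_right_one` / `_of_left_negOne` — **Theorem 3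
  across one even atom, one odd atom (`|K| ≥ 3`), on `[1,v]`, on `[u,−1]`**, from (W-ii) + (W-even) /
  (W-odd) / (W-one) (and RH for the boundedness of `P_0`), in the typed rendering with
  `P_0(T) = AH.binDensity 0 T M δ`.
* `bgstb2025_theorem3_of_inputs` — **the conclusion of the typed `bgstb2025_theorem3` VERBATIM (every admissible
  `[a,b]`, every Riemann-integrable `g` with the printed pointwise Lipschitz conditions, `∀ δ → ∀ᶠ M → Tendsto_T`)
  from RH and the window inputs (W-ii), (W-even), (W-odd), (W-one)**, by strong induction on the number of
  half-integers inside `(a,b)`; `bgstb2025_theorem3_of_windows` — hence `bgstb2025_theorem3` itself, modulo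
  "RH ∧ AH-Pairs ⇒ the window inputs" (BGSTB Lemma 6 with `M`-uniform constants; cell row «U»).

## References

* [BaluyotGoldstonSuriajayaTurnageButterbaugh2025] arXiv:2508.10857, §2 (calF), Theorem 3; §7 (proof of
  Theorem 3), TeX l.1058–1090. [claim: BaluyotGoldstonSuriajayaTurnageButterbaugh2025, status: under-review]
* [Montgomery1973] H. L. Montgomery, *The pair correlation of zeros of the zeta function*, §1 (1) (`F`).
* [LagariasRodgers2020] J. C. Lagarias, B. Rodgers, §2.3 (2.3) (the sawtooth `s`).
-/

noncomputable section

open MeasureTheory Filter Set Topology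
open scoped Topology Interval Real

namespace Literature.NumberTheory.LFunctions.AH.Thm3

/-! ### The sawtooth `s = triangleWave` is continuous -/

/-- The sawtooth `s(ξ) = |ξ − 2·round(ξ/2)|` is the quotient norm of `ξ` in `ℝ/2ℤ`
(Mathlib's `AddCircle.norm_eq`). [cite: LagariasRodgers2020, §2.3 (2.3)] -/
theorem triangleWave_eq_norm (ξ : ℝ) : triangleWave ξ = ‖((ξ : ℝ) : AddCircle (2 : ℝ))‖ := by
  rw [AddCircle.norm_eq, triangleWave, inv_mul_eq_div]
  congr 1
  ring

/-- The sawtooth `s` ("`s(α) = |α|` for `|α| ≤ 1`, and `s(α+2) = s(α)` for all `α`", BGSTB 2025, (calF))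
is continuous. [cite: BaluyotGoldstonSuriajayaTurnageButterbaugh2025, §2 (calF)] -/
theorem continuous_triangleWave : Continuous triangleWave := by
  have h : triangleWave = fun ξ : ℝ ↦ ‖((ξ : ℝ) : AddCircle (2 : ℝ))‖ := funext triangleWave_eq_norm
  rw [h]
  exact continuous_norm.comp (AddCircle.continuous_mk' (2 : ℝ))

/-! ### `∫_a^b 𝓕 g` on an integer-free interval, and its additivity in the interval -/

/-- An interval `[a,b]` containing no integer carries no integer strictly between `⌊a⌋` and `⌈b⌉`
(bookkeeping for "`[a,b] ⊂ (N+λ,N+1−λ)`", §7). [cite: BaluyotGoldstonSuriajayaTurnageButterbaugh2025, §7 (proof of Theorem 3)] -/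
theorem Ioo_floor_ceil_eq_empty {a b : ℝ} (hZ : ∀ n : ℤ, (n : ℝ) ∉ Icc a b) :
    Finset.Ioo ⌊a⌋ ⌈b⌉ = ∅ := by
  refine Finset.eq_empty_iff_forall_notMem.mpr fun m hm ↦ ?_
  rw [Finset.mem_Ioo, Int.floor_lt, Int.lt_ceil] at hm
  exact hZ m ⟨hm.1.le, hm.2.le⟩

/-- **On an integer-free interval only the sawtooth part of `𝓕` is seen**: if `[a,b]` contains no integer,
`AH.calFIntegral P₀ a b g = ∫_a^b s(α) g(α) dα` for every `P₀` (BGSTB 2025, (calF): the masses of `𝓕` sit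
at the integers). [cite: BaluyotGoldstonSuriajayaTurnageButterbaugh2025, §2 (calF)] -/
theorem calFIntegral_eq_of_intFree (P₀ : ℝ) {a b : ℝ} (hZ : ∀ n : ℤ, (n : ℝ) ∉ Icc a b)
    (g : ℝ → ℝ) : AH.calFIntegral P₀ a b g = ∫ α in a..b, triangleWave α * g α := by
  unfold AH.calFIntegral
  have h0 := hZ 0
  have h1 := hZ 1
  have hm1 := hZ (-1)
  push_cast at h0 h1 hm1
  rw [mem_Icc, not_and_or, not_le, not_le] at h0 h1 hm1
  have e1 : (if a < 0 ∧ 0 ≤ b then (1 : ℝ) / 2 else 0) = 0 :=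
    if_neg fun h ↦ by rcases h0 with h0 | h0 <;> linarith [h.1, h.2]
  have e2 : (if a ≤ 0 ∧ 0 < b then (1 : ℝ) / 2 else 0) = 0 :=
    if_neg fun h ↦ by rcases h0 with h0 | h0 <;> linarith [h.1, h.2]
  have e3 : (if a ≤ 1 ∧ 1 < b then (1 : ℝ) else 0) = 0 :=
    if_neg fun h ↦ by rcases h1 with h1 | h1 <;> linarith [h.1, h.2]
  have e4 : (if a < -1 ∧ -1 ≤ b then (1 : ℝ) else 0) = 0 :=
    if_neg fun h ↦ by rcases hm1 with hm1 | hm1 <;> linarith [h.1, h.2]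
  rw [e1, e2, e3, e4, Ioo_floor_ceil_eq_empty hZ]
  simp

/-- Splitting the sums over the integers strictly inside `(a,b)` at a point `c ∈ [a,b]` that is not one of
the integers being summed (bookkeeping for the decomposition of `[a,b]` in §7).
[cite: BaluyotGoldstonSuriajayaTurnageButterbaugh2025, §7 (proof of Theorem 3)] -/
theorem sum_filter_Ioo_add {p : ℤ → Prop} [DecidablePred p] {a c b : ℝ} (hac : a ≤ c) (hcb : c ≤ b)
    (hc : ∀ m : ℤ, p m → (c : ℝ) ≠ m) (f : ℤ → ℝ) :
    ∑ m ∈ (Finset.Ioo ⌊a⌋ ⌈c⌉).filter p, f m + ∑ m ∈ (Finset.Ioo ⌊c⌋ ⌈b⌉).filter p, f m =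
      ∑ m ∈ (Finset.Ioo ⌊a⌋ ⌈b⌉).filter p, f m := by
  rw [← Finset.sum_union]
  · congr 1
    ext m
    simp only [Finset.mem_union, Finset.mem_filter, Finset.mem_Ioo, Int.floor_lt, Int.lt_ceil]
    constructor
    · rintro (⟨⟨h1, h2⟩, hp⟩ | ⟨⟨h1, h2⟩, hp⟩)
      · exact ⟨⟨h1, lt_of_lt_of_le h2 hcb⟩, hp⟩
      · exact ⟨⟨lt_of_le_of_lt hac h1, h2⟩, hp⟩
    · rintro ⟨⟨h1, h2⟩, hp⟩
      rcases lt_trichotomy (m : ℝ) c with h | h | h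
      · exact Or.inl ⟨⟨h1, h⟩, hp⟩
      · exact absurd h.symm (hc m hp)
      · exact Or.inr ⟨⟨h, h2⟩, hp⟩
  · rw [Finset.disjoint_left]
    intro m hm hm'
    simp only [Finset.mem_filter, Finset.mem_Ioo, Int.floor_lt, Int.lt_ceil] at hm hm'
    linarith [hm.1.2, hm'.1.1]

/-- The half-masses of `δ_0^=` ((calF): "`δ_0^=`, half of the mass on each side of `0`") split consistently
at any `c ∈ [a,b]`. [cite: BaluyotGoldstonSuriajayaTurnageButterbaugh2025, §2 (calF)] -/
theorem atomZero_add {a c b : ℝ} (hac : a ≤ c) (hcb : c ≤ b) :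
    ((if a < 0 ∧ 0 ≤ c then (1 : ℝ) / 2 else 0) + (if a ≤ 0 ∧ 0 < c then (1 : ℝ) / 2 else 0)) +
      ((if c < 0 ∧ 0 ≤ b then (1 : ℝ) / 2 else 0) + (if c ≤ 0 ∧ 0 < b then (1 : ℝ) / 2 else 0)) =
      (if a < 0 ∧ 0 ≤ b then (1 : ℝ) / 2 else 0) + (if a ≤ 0 ∧ 0 < b then (1 : ℝ) / 2 else 0) := by
  simp only [ite_and]
  split_ifs <;> first | rfl | (exfalso; linarith) | linarith

/-- The one-sided mass `δ_1^+` of (calF) splits consistently at any `c ∈ [a,b]`.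
[cite: BaluyotGoldstonSuriajayaTurnageButterbaugh2025, §2 (calF)] -/
theorem atomOne_add {a c b : ℝ} (hac : a ≤ c) (hcb : c ≤ b) :
    (if a ≤ 1 ∧ 1 < c then (1 : ℝ) else 0) + (if c ≤ 1 ∧ 1 < b then (1 : ℝ) else 0) =
      (if a ≤ 1 ∧ 1 < b then (1 : ℝ) else 0) := by
  simp only [ite_and]
  split_ifs <;> first | rfl | (exfalso; linarith) | linarith

/-- The one-sided mass `δ_{−1}^−` of (calF) splits consistently at any `c ∈ [a,b]`.
[cite: BaluyotGoldstonSuriajayaTurnageButterbaugh2025, §2 (calF)] -/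
theorem atomNegOne_add {a c b : ℝ} (hac : a ≤ c) (hcb : c ≤ b) :
    (if a < -1 ∧ -1 ≤ c then (1 : ℝ) else 0) + (if c < -1 ∧ -1 ≤ b then (1 : ℝ) else 0) =
      (if a < -1 ∧ -1 ≤ b then (1 : ℝ) else 0) := by
  simp only [ite_and]
  split_ifs <;> first | rfl | (exfalso; linarith) | linarith

/-- **Additivity of `∫_a^b 𝓕 g` in the interval** at every splitting point `c ∈ [a,b]` with
`c ∉ ℤ ∖ {−1, 0, 1}` (the endpoint convention of the typed `bgstb2025_theorem3`): the one-sided masses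
`δ_0^=`, `δ_1^+`, `δ_{−1}^−` of (calF) and the full masses at the other integers are each counted exactly once.
(Our bookkeeping lemma for the printed decomposition "`∫_a^b Fg = ∫_a^{N−λ} + ∑ ∫_{j−λ}^{j+λ} + ⋯`", §7.)
[cite: BaluyotGoldstonSuriajayaTurnageButterbaugh2025, §7 (proof of Theorem 3)] -/
theorem calFIntegral_add (P₀ : ℝ) {a c b : ℝ} (hac : a ≤ c) (hcb : c ≤ b)
    (hc : ∀ m : ℤ, m ≠ -1 → m ≠ 0 → m ≠ 1 → (c : ℝ) ≠ m) {g : ℝ → ℝ}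
    (hga : IntervalIntegrable (fun α ↦ triangleWave α * g α) volume a c)
    (hgb : IntervalIntegrable (fun α ↦ triangleWave α * g α) volume c b) :
    AH.calFIntegral P₀ a c g + AH.calFIntegral P₀ c b g = AH.calFIntegral P₀ a b g := by
  unfold AH.calFIntegral
  rw [← intervalIntegral.integral_add_adjacent_intervals hga hgb, ← atomZero_add hac hcb,
    ← atomOne_add hac hcb, ← atomNegOne_add hac hcb,
    ← sum_filter_Ioo_add (p := fun m : ℤ ↦ Even m ∧ m ≠ 0) hac hcb ?_ (fun m ↦ g m),
    ← sum_filter_Ioo_add (p := fun m : ℤ ↦ Odd m ∧ 3 ≤ |m|) hac hcb ?_ (fun m ↦ g m)]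
  · ring
  · rintro m ⟨hodd, h3⟩
    refine hc m ?_ ?_ ?_ <;> rintro rfl <;> simp at h3
  · rintro m ⟨heven, hm0⟩
    refine hc m ?_ hm0 ?_ <;> rintro rfl <;> simp at heven

/-! ### Joining `o(1)` statements on adjacent intervals -/

/-- If `∫_a^c F g − ∫_a^c 𝓕 g → 0` and `∫_c^b F g − ∫_c^b 𝓕 g → 0` along `T → ∞`, with `c ∈ [a,b]`,
`c ∉ ℤ ∖ {−1,0,1}`, then `∫_a^b F g − ∫_a^b 𝓕 g → 0` (the book-keeping behind "since each integral in the
middle step has been evaluated above to give the right-hand side", §7).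
[cite: BaluyotGoldstonSuriajayaTurnageButterbaugh2025, §7 (proof of Theorem 3)] -/
theorem tendsto_sub_calFIntegral_add {a c b : ℝ} (hac : a ≤ c) (hcb : c ≤ b)
    (hc : ∀ m : ℤ, m ≠ -1 → m ≠ 0 → m ≠ 1 → (c : ℝ) ≠ m) {g : ℝ → ℝ} {P₀ : ℝ → ℝ}
    (hFa : ∀ᶠ T : ℝ in atTop, IntervalIntegrable (fun α ↦ montgomeryFormFactor α T * g α) volume a c)
    (hFb : ∀ᶠ T : ℝ in atTop, IntervalIntegrable (fun α ↦ montgomeryFormFactor α T * g α) volume c b)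
    (hga : IntervalIntegrable (fun α ↦ triangleWave α * g α) volume a c)
    (hgb : IntervalIntegrable (fun α ↦ triangleWave α * g α) volume c b)
    (h₁ : Tendsto (fun T : ℝ ↦ (∫ α in a..c, montgomeryFormFactor α T * g α) -
      AH.calFIntegral (P₀ T) a c g) atTop (𝓝 0))
    (h₂ : Tendsto (fun T : ℝ ↦ (∫ α in c..b, montgomeryFormFactor α T * g α) -
      AH.calFIntegral (P₀ T) c b g) atTop (𝓝 0)) :
    Tendsto (fun T : ℝ ↦ (∫ α in a..b, montgomeryFormFactor α T * g α) -
      AH.calFIntegral (P₀ T) a b g) atTop (𝓝 0) := by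
  have h := h₁.add h₂
  rw [add_zero] at h
  refine h.congr' ?_
  filter_upwards [hFa, hFb] with T hTa hTb
  rw [← intervalIntegral.integral_add_adjacent_intervals hTa hTb, ← calFIntegral_add (P₀ T) hac hcb hc hga hgb]
  ring

/-! ### The integer-free conjunct of Theorem 3 from the window input (W-ii) -/

/-- Every integer below a real `u` is at most `⌈u⌉ − 1`, and `⌈u⌉ − 1 < u`; every integer above `v` is at
least `⌊v⌋ + 1 > v`. Packaged: on an integer-free `[u,v]`, a window `[α−λ, α+λ] ⊆ [u,v]` with
`λ ≤ min (u − (⌈u⌉−1)) ((⌊v⌋+1) − v)` is at distance `≥ 2λ` from every integer (bookkeeping for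
"taking `λ < min(‖a‖,‖b‖)`", §7). [cite: BaluyotGoldstonSuriajayaTurnageButterbaugh2025, §7 (proof of Theorem 3)] -/
theorem two_mul_le_abs_sub_int {u v lam α : ℝ} (hZ : ∀ n : ℤ, (n : ℝ) ∉ Icc u v) (hlam : 0 ≤ lam)
    (hlu : lam ≤ u - ((⌈u⌉ : ℤ) - 1 : ℝ)) (hlv : lam ≤ ((⌊v⌋ : ℤ) + 1 : ℝ) - v)
    (hαu : u ≤ α - lam) (hαv : α + lam ≤ v) (n : ℤ) : 2 * lam ≤ |α - n| := by
  rcases lt_or_ge (n : ℝ) u with hnu | hnu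
  · -- `n < u`, so `n ≤ ⌈u⌉ - 1`
    have hn : n ≤ ⌈u⌉ - 1 := by
      have : n < ⌈u⌉ := Int.cast_lt.mp (lt_of_lt_of_le hnu (Int.le_ceil u))
      omega
    have hn' : (n : ℝ) ≤ (⌈u⌉ : ℝ) - 1 := by exact_mod_cast hn
    rw [abs_of_nonneg (by linarith)]
    linarith
  · rcases le_or_gt (n : ℝ) v with hnv | hnv
    · exact absurd ⟨hnu, hnv⟩ (hZ n)
    · -- `v < n`, so `⌊v⌋ + 1 ≤ n`
      have hn : ⌊v⌋ + 1 ≤ n := by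
        have : ⌊v⌋ < n := Int.cast_lt.mp (lt_of_le_of_lt (Int.floor_le v) hnv)
        omega
      have hn' : (⌊v⌋ : ℝ) + 1 ≤ (n : ℝ) := by exact_mod_cast hn
      rw [abs_of_nonpos (by linarith)]
      linarith

/-- **BGSTB 2025, Theorem 3 on an integer-free interval, from the window input (W-ii)** (the conjunct
"Now suppose `[a,b] ⊂ (N+λ,N+1−λ)` … Thus by approximation this also holds for any Riemann integrable
function `g(α)`" of §7). Hypothesis `hWii` is Lemma 6 (ii) in `M`-free limit form along `T → ∞` (our
rendering): for every `K` and `ε > 0` there is `λ₀ > 0` such that for all `0 < λ ≤ λ₀`, for all large `T`,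
`|(1/2λ) ∫_{α−λ}^{α+λ} F(β,T) dβ − s(α)| ≤ ε` whenever `|α| ≤ K` and `dist(α, ℤ) ≥ 2λ`. Conclusion: for
`a ≤ b` with no integer in `[a,b]` and `g` bounded on `[a,b]` and continuous within `[a,b]` at almost every
point, `∫_a^b F(α,T) g(α) dα − AH.calFIntegral (P₀ T) a b g → 0` for EVERY `P₀ : ℝ → ℝ` (no mass of `𝓕`
meets `[a,b]`), in particular for `P₀ T = AH.binDensity 0 T M δ`, every `M`, `δ`. Proof: the tree's tiling
and weak-convergence lemmas (`AH.tendsto_intervalIntegral_of_window`,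
`AH.tendsto_intervalIntegral_mul_of_tendsto_intervalIntegral`), `F ≥ 0` for `T > 1`
(`Montgomery.montgomeryFormFactor_nonneg`) and the continuity of `s`.
[cite: BaluyotGoldstonSuriajayaTurnageButterbaugh2025, §7 (proof of Theorem 3)] -/
theorem tendsto_sub_calFIntegral_of_intFree
    (hWii : ∀ K : ℝ, ∀ ε > 0, ∃ lam0 > 0, ∀ lam : ℝ, 0 < lam → lam ≤ lam0 → ∀ᶠ T : ℝ in atTop,
      ∀ α : ℝ, |α| ≤ K → (∀ n : ℤ, 2 * lam ≤ |α - n|) →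
        |1 / (2 * lam) * (∫ β in (α - lam)..(α + lam), montgomeryFormFactor β T) - triangleWave α| ≤ ε)
    {a b : ℝ} (hab : a ≤ b) (hZ : ∀ n : ℤ, (n : ℝ) ∉ Icc a b) {g : ℝ → ℝ}
    (hbdd : ∃ B : ℝ, ∀ x ∈ Icc a b, |g x| ≤ B)
    (hcont : ∀ᵐ x ∂(volume.restrict (Icc a b)), ContinuousWithinAt g (Icc a b) x) (P₀ : ℝ → ℝ) :
    Tendsto (fun T : ℝ ↦ (∫ α in a..b, montgomeryFormFactor α T * g α) -
      AH.calFIntegral (P₀ T) a b g) atTop (𝓝 0) := by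
  obtain ⟨B, hB⟩ := hbdd
  -- the margins of `[a,b]` to the integers
  have hd₁ : 0 < a - ((⌈a⌉ : ℤ) - 1 : ℝ) := by linarith [Int.ceil_lt_add_one a]
  have hd₂ : 0 < ((⌊b⌋ : ℤ) + 1 : ℝ) - b := by linarith [Int.lt_floor_add_one b]
  -- distribution functions converge on `[a,b]`, by tiling
  have hA : ∀ x ∈ Icc a b, Tendsto (fun T : ℝ ↦ ∫ t in a..x, montgomeryFormFactor t T) atTop
      (𝓝 (∫ t in a..x, triangleWave t)) := by
    intro x hx
    refine AH.tendsto_intervalIntegral_of_window (l := atTop)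
      (F := fun T t ↦ montgomeryFormFactor t T) RudnickSarnak.continuous_montgomeryFormFactor
      continuous_triangleWave.continuousOn ?_ hx
    intro ε hε
    obtain ⟨lam0, hlam0, h⟩ := hWii (max |a| |b|) ε hε
    refine ⟨min lam0 (min (a - ((⌈a⌉ : ℤ) - 1 : ℝ)) (((⌊b⌋ : ℤ) + 1 : ℝ) - b)),
      lt_min hlam0 (lt_min hd₁ hd₂), fun lam hlam hlamle ↦ ?_⟩
    have hl0 : lam ≤ lam0 := hlamle.trans (min_le_left _ _)
    have hl1 : lam ≤ a - ((⌈a⌉ : ℤ) - 1 : ℝ) := hlamle.trans ((min_le_right _ _).trans (min_le_left _ _))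
    have hl2 : lam ≤ ((⌊b⌋ : ℤ) + 1 : ℝ) - b := hlamle.trans ((min_le_right _ _).trans (min_le_right _ _))
    filter_upwards [h lam hlam hl0] with T hT α hαa hαb
    refine hT α ?_ (two_mul_le_abs_sub_int hZ hlam.le hl1 hl2 hαa hαb)
    rw [abs_le]
    constructor
    · linarith [neg_abs_le a, le_max_left |a| |b|]
    · linarith [le_abs_self b, le_max_right |a| |b|]
  -- hence test functions converge
  have hlim : Tendsto (fun T : ℝ ↦ ∫ α in a..b, montgomeryFormFactor α T * g α) atTop
      (𝓝 (∫ α in a..b, triangleWave α * g α)) :=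
    AH.tendsto_intervalIntegral_mul_of_tendsto_intervalIntegral (l := atTop)
      (F := fun T t ↦ montgomeryFormFactor t T) hab RudnickSarnak.continuous_montgomeryFormFactor
      (by filter_upwards [eventually_gt_atTop (1 : ℝ)] with T hT x _
            using Montgomery.montgomeryFormFactor_nonneg x hT)
      continuous_triangleWave.continuousOn (fun x _ ↦ triangleWave_nonneg x) hA hB hcont
  have hcalF : ∀ T, AH.calFIntegral (P₀ T) a b g = ∫ α in a..b, triangleWave α * g α :=
    fun T ↦ calFIntegral_eq_of_intFree (P₀ T) hZ g
  simp_rw [hcalF]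
  rw [← sub_self (∫ α in a..b, triangleWave α * g α)]
  exact hlim.sub_const _


/-! ### Plumbing: integrability of `F·g`, `s·g` on sub-intervals; `s ≤ 1`; a.e.-continuity on sub-intervals -/

/-- `s ≤ 1` (the distance to the nearest even integer is at most `1`). [cite: LagariasRodgers2020, §2.3 (2.3)] -/
theorem triangleWave_le_one (ξ : ℝ) : triangleWave ξ ≤ 1 := by
  rw [triangleWave_eq_norm]
  have h := AddCircle.norm_le_half_period (2 : ℝ) (x := ((ξ : ℝ) : AddCircle (2 : ℝ))) two_ne_zero
  norm_num at h
  exact h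

/-- A function bounded and a.e.-strongly measurable on `[u, v]` is interval integrable on every
`[x, y] ⊆ [u, v]`. [folklore] -/
private theorem intervalIntegrable_of_bdd {g : ℝ → ℝ} {u v B x y : ℝ} (hB : ∀ t ∈ Icc u v, |g t| ≤ B)
    (hgm : AEStronglyMeasurable g (volume.restrict (Icc u v))) (hx : x ∈ Icc u v) (hy : y ∈ Icc u v) :
    IntervalIntegrable g volume x y := by
  have hint : IntegrableOn g (Icc u v) volume := by
    refine Integrable.mono' (integrable_const B) hgm ?_
    exact (ae_restrict_iff' measurableSet_Icc).2 (Eventually.of_forall fun t ht ↦ by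
      rw [Real.norm_eq_abs]; exact hB t ht)
  exact (hint.mono_set (uIcc_subset_Icc hx hy)).intervalIntegrable

/-- `F(·,T)·g` is interval integrable on every `[x, y] ⊆ [u, v]` for `g` bounded and a.e.-strongly measurable
on `[u, v]`. [folklore] -/
private theorem intervalIntegrable_formFactor_mul {g : ℝ → ℝ} {u v B x y : ℝ} (hB : ∀ t ∈ Icc u v, |g t| ≤ B)
    (hgm : AEStronglyMeasurable g (volume.restrict (Icc u v))) (hx : x ∈ Icc u v) (hy : y ∈ Icc u v)
    (T : ℝ) : IntervalIntegrable (fun α ↦ montgomeryFormFactor α T * g α) volume x y :=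
  (intervalIntegrable_of_bdd hB hgm hx hy).continuousOn_mul (RudnickSarnak.continuous_montgomeryFormFactor T).continuousOn

/-- `s·g` is interval integrable on every `[x, y] ⊆ [u, v]` for `g` bounded and a.e.-strongly measurable on
`[u, v]`. [folklore] -/
private theorem intervalIntegrable_triangleWave_mul {g : ℝ → ℝ} {u v B x y : ℝ} (hB : ∀ t ∈ Icc u v, |g t| ≤ B)
    (hgm : AEStronglyMeasurable g (volume.restrict (Icc u v))) (hx : x ∈ Icc u v) (hy : y ∈ Icc u v) :
    IntervalIntegrable (fun α ↦ triangleWave α * g α) volume x y :=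
  (intervalIntegrable_of_bdd hB hgm hx hy).continuousOn_mul continuous_triangleWave.continuousOn

/-- The Lebesgue-criterion binder passes to sub-intervals. [folklore] -/
private theorem ae_continuousWithinAt_mono {g : ℝ → ℝ} {u v x y : ℝ}
    (hcont : ∀ᵐ t ∂(volume.restrict (Icc u v)), ContinuousWithinAt g (Icc u v) t)
    (hx : x ∈ Icc u v) (hy : y ∈ Icc u v) :
    ∀ᵐ t ∂(volume.restrict (Icc x y)), ContinuousWithinAt g (Icc x y) t := by
  have hsub : Icc x y ⊆ Icc u v := fun t ht ↦ ⟨hx.1.trans ht.1, ht.2.trans hy.2⟩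
  exact (ae_restrict_of_ae_restrict_of_subset hsub hcont).mono fun t ht ↦ ht.mono hsub

/-- `|∫_x^y s·g| ≤ B (y − x)` on `[x, y] ⊆ [u, v]` when `|g| ≤ B` on `[u, v]` (`0 ≤ s ≤ 1`). [folklore] -/
private theorem abs_integral_triangleWave_mul_le {g : ℝ → ℝ} {u v B x y : ℝ} (hB : ∀ t ∈ Icc u v, |g t| ≤ B)
    (hx : x ∈ Icc u v) (hy : y ∈ Icc u v) (hxy : x ≤ y) :
    |∫ α in x..y, triangleWave α * g α| ≤ B * (y - x) := by
  have h := intervalIntegral.norm_integral_le_of_norm_le_const (a := x) (b := y) (C := B)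
    (f := fun α ↦ triangleWave α * g α) ?_
  · rw [Real.norm_eq_abs, abs_of_nonneg (sub_nonneg.2 hxy)] at h
    exact h
  · intro t ht
    rw [uIoc_of_le hxy] at ht
    have htI : t ∈ Icc u v := ⟨hx.1.trans ht.1.le, ht.2.trans hy.2⟩
    rw [Real.norm_eq_abs, abs_mul, abs_of_nonneg (triangleWave_nonneg t)]
    calc triangleWave t * |g t| ≤ 1 * B :=
        mul_le_mul (triangleWave_le_one t) (hB t htI) (abs_nonneg _) zero_le_one
      _ = B := one_mul B

/-! ### A two-sided atom: window masses + continuity of `g` at the atom -/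

/-- **The window around one interior atom, two-sided** (BGSTB 2025, §7: "Next consider a function `g(α)`
which is Lipschitz continuous at `α = N ∈ ℤ`. Then `∫_{N−λ}^{N+λ} F(α) g(α) dα ∼ g(N) ∫_{N−λ}^{N+λ} 𝓕(α) dα`"
combined with the integer-free flanks). Our composition, in limit form: on `[u, v]` whose only integer point
(if any) is `n`, `u < n < v`, with `g` bounded on `[u, v]`, continuous within `[u, v]` almost everywhere and
continuous at `n`, given (W-ii) and the mass input at `n` — for every `ε > 0` there is `λ₀ > 0` such that for
all `0 < λ ≤ λ₀`, for all large `T`, `|∫_{n−λ}^{n+λ} F(β,T) dβ − c(T)| ≤ ε` — with `c(T)` eventually bounded,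
one has `∫_u^v F(α,T) g(α) dα − (∫_u^v s(α) g(α) dα + c(T) g(n)) → 0`.
[cite: BaluyotGoldstonSuriajayaTurnageButterbaugh2025, §7 (proof of Theorem 3)] -/
theorem tendsto_sub_of_atom
    (hWii : ∀ K : ℝ, ∀ ε > 0, ∃ lam0 > 0, ∀ lam : ℝ, 0 < lam → lam ≤ lam0 → ∀ᶠ T : ℝ in atTop,
      ∀ α : ℝ, |α| ≤ K → (∀ n : ℤ, 2 * lam ≤ |α - n|) →
        |1 / (2 * lam) * (∫ β in (α - lam)..(α + lam), montgomeryFormFactor β T) - triangleWave α| ≤ ε)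
    {u v n : ℝ} (hun : u < n) (hnv : n < v) (hZ : ∀ k : ℤ, (k : ℝ) ∈ Icc u v → (k : ℝ) = n)
    {g : ℝ → ℝ} {B : ℝ} (hB : ∀ x ∈ Icc u v, |g x| ≤ B)
    (hcont : ∀ᵐ x ∂(volume.restrict (Icc u v)), ContinuousWithinAt g (Icc u v) x)
    (hgn : ContinuousAt g n) {c : ℝ → ℝ} (hcb : ∃ cb : ℝ, ∀ᶠ T : ℝ in atTop, |c T| ≤ cb)
    (hWn : ∀ ε > 0, ∃ lam0 > 0, ∀ lam : ℝ, 0 < lam → lam ≤ lam0 → ∀ᶠ T : ℝ in atTop,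
      |(∫ β in (n - lam)..(n + lam), montgomeryFormFactor β T) - c T| ≤ ε) :
    Tendsto (fun T : ℝ ↦ (∫ α in u..v, montgomeryFormFactor α T * g α) -
      ((∫ α in u..v, triangleWave α * g α) + c T * g n)) atTop (𝓝 0) := by
  obtain ⟨cb, hcbT⟩ := hcb
  obtain ⟨T₁, hT₁⟩ := hcbT.exists
  have hcb0 : 0 ≤ cb := (abs_nonneg _).trans hT₁
  have huv : u ≤ v := (hun.trans hnv).le
  have hB0 : 0 ≤ B := (abs_nonneg _).trans (hB u (left_mem_Icc.2 huv))
  have hgm : AEStronglyMeasurable g (volume.restrict (Icc u v)) :=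
    AH.aestronglyMeasurable_of_ae_continuousWithinAt hcont
  rw [Metric.tendsto_nhds]
  intro η hη
  -- the modulus of `g` at `n`
  set ε₁ : ℝ := η / (4 * (cb + 2)) with hε₁_def
  have hε₁ : 0 < ε₁ := by positivity
  have hε₁' : ε₁ * (cb + 1) ≤ η / 4 := by
    have e : ε₁ * (cb + 2) = η / 4 := by rw [hε₁_def]; field_simp
    nlinarith
  obtain ⟨ρ, hρ, hgρ⟩ : ∃ ρ > 0, ∀ x : ℝ, |x - n| < ρ → |g x - g n| < ε₁ := by
    obtain ⟨ρ, hρ, h⟩ := Metric.continuousAt_iff.mp hgn ε₁ hε₁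
    exact ⟨ρ, hρ, fun x hx ↦ by simpa [Real.dist_eq] using h (by simpa [Real.dist_eq] using hx)⟩
  -- the mass tolerance
  set ε₂ : ℝ := min 1 (η / (4 * (|g n| + 1))) with hε₂_def
  have hε₂ : 0 < ε₂ := by positivity
  have hε₂1 : ε₂ ≤ 1 := min_le_left _ _
  have hε₂' : |g n| * ε₂ ≤ η / 4 := by
    have e : (|g n| + 1) * (η / (4 * (|g n| + 1))) = η / 4 := by
      rw [mul_comm, div_mul_eq_mul_div, mul_div_mul_right _ _ (by positivity : (|g n| + 1) ≠ 0)]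
    have h1 : |g n| * ε₂ ≤ |g n| * (η / (4 * (|g n| + 1))) :=
      mul_le_mul_of_nonneg_left (min_le_right _ _) (abs_nonneg _)
    have h2 : |g n| * (η / (4 * (|g n| + 1))) ≤ (|g n| + 1) * (η / (4 * (|g n| + 1))) :=
      mul_le_mul_of_nonneg_right (by linarith) (by positivity)
    linarith
  obtain ⟨lam0, hlam0, hW⟩ := hWn ε₂ hε₂
  -- the scale `λ`
  set lam : ℝ := min (min lam0 (ρ / 2)) (min (min ((n - u) / 2) ((v - n) / 2)) (η / (8 * (B + 1))))
    with hlam_def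
  have hlam : 0 < lam := by
    rw [hlam_def]
    refine lt_min (lt_min hlam0 (by positivity)) (lt_min (lt_min ?_ ?_) (by positivity)) <;> linarith
  have hl0 : lam ≤ lam0 := (min_le_left _ _).trans (min_le_left _ _)
  have hlρ : lam ≤ ρ / 2 := (min_le_left _ _).trans (min_le_right _ _)
  have hlu : lam ≤ (n - u) / 2 := (min_le_right _ _).trans ((min_le_left _ _).trans (min_le_left _ _))
  have hlv : lam ≤ (v - n) / 2 := (min_le_right _ _).trans ((min_le_left _ _).trans (min_le_right _ _))
  have hlη : lam ≤ η / (8 * (B + 1)) := (min_le_right _ _).trans (min_le_right _ _)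
  have hlη' : B * (2 * lam) ≤ η / 4 := by
    have e : (B + 1) * (2 * (η / (8 * (B + 1)))) = η / 4 := by
      rw [show (B + 1) * (2 * (η / (8 * (B + 1)))) = (2 * η) * (B + 1) / (8 * (B + 1)) by ring,
        mul_div_mul_right _ _ (by positivity : (B + 1) ≠ 0)]
      ring
    have h1 : B * (2 * lam) ≤ B * (2 * (η / (8 * (B + 1)))) := by gcongr
    have h2 : B * (2 * (η / (8 * (B + 1)))) ≤ (B + 1) * (2 * (η / (8 * (B + 1)))) :=
      mul_le_mul_of_nonneg_right (by linarith) (by positivity)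
    linarith
  have hu' : u ≤ n - lam := by linarith
  have hv' : n + lam ≤ v := by linarith
  have hm₁ : n - lam ∈ Icc u v := ⟨hu', by linarith⟩
  have hm₂ : n + lam ∈ Icc u v := ⟨by linarith, hv'⟩
  -- the flanks are integer-free
  have hZ₁ : ∀ k : ℤ, (k : ℝ) ∉ Icc u (n - lam) := fun k hk ↦ by
    have := hZ k ⟨hk.1, hk.2.trans (by linarith)⟩; linarith [hk.2]
  have hZ₂ : ∀ k : ℤ, (k : ℝ) ∉ Icc (n + lam) v := fun k hk ↦ by
    have := hZ k ⟨le_trans (by linarith) hk.1, hk.2⟩; linarith [hk.1]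
  have hfl₁ := tendsto_sub_calFIntegral_of_intFree hWii hu' hZ₁
    ⟨B, fun x hx ↦ hB x ⟨hx.1, hx.2.trans hm₁.2⟩⟩
    (ae_continuousWithinAt_mono hcont (left_mem_Icc.2 huv) hm₁) (fun _ ↦ 0)
  have hfl₂ := tendsto_sub_calFIntegral_of_intFree hWii hv' hZ₂
    ⟨B, fun x hx ↦ hB x ⟨hm₂.1.trans hx.1, hx.2⟩⟩
    (ae_continuousWithinAt_mono hcont hm₂ (right_mem_Icc.2 huv)) (fun _ ↦ 0)
  simp_rw [calFIntegral_eq_of_intFree _ hZ₁, calFIntegral_eq_of_intFree _ hZ₂] at hfl₁ hfl₂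
  have e₁ := Metric.tendsto_nhds.mp hfl₁ (η / 8) (by positivity)
  have e₂ := Metric.tendsto_nhds.mp hfl₂ (η / 8) (by positivity)
  filter_upwards [e₁, e₂, hW lam hlam hl0, hcbT, eventually_gt_atTop (1 : ℝ)] with T h₁ h₂ h₃ hcT hT1
  rw [Real.dist_eq, sub_zero] at h₁ h₂ ⊢
  have hF0 : ∀ x, 0 ≤ montgomeryFormFactor x T := fun x ↦ Montgomery.montgomeryFormFactor_nonneg x hT1
  -- splitting at `n - λ` and `n + λ`
  have iF := fun {x y : ℝ} (hx : x ∈ Icc u v) (hy : y ∈ Icc u v) ↦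
    intervalIntegrable_formFactor_mul hB hgm hx hy T
  have iS := fun {x y : ℝ} (hx : x ∈ Icc u v) (hy : y ∈ Icc u v) ↦
    intervalIntegrable_triangleWave_mul hB hgm hx hy
  have hu0 : u ∈ Icc u v := left_mem_Icc.2 huv
  have hv0 : v ∈ Icc u v := right_mem_Icc.2 huv
  have sF : ∫ α in u..v, montgomeryFormFactor α T * g α =
      (∫ α in u..(n - lam), montgomeryFormFactor α T * g α) +
        (∫ α in (n - lam)..(n + lam), montgomeryFormFactor α T * g α) +
        ∫ α in (n + lam)..v, montgomeryFormFactor α T * g α := by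
    rw [intervalIntegral.integral_add_adjacent_intervals (iF hu0 hm₁) (iF hm₁ hm₂),
      intervalIntegral.integral_add_adjacent_intervals ((iF hu0 hm₁).trans (iF hm₁ hm₂)) (iF hm₂ hv0)]
  have sS : ∫ α in u..v, triangleWave α * g α =
      (∫ α in u..(n - lam), triangleWave α * g α) +
        (∫ α in (n - lam)..(n + lam), triangleWave α * g α) +
        ∫ α in (n + lam)..v, triangleWave α * g α := by
    rw [intervalIntegral.integral_add_adjacent_intervals (iS hu0 hm₁) (iS hm₁ hm₂),
      intervalIntegral.integral_add_adjacent_intervals ((iS hu0 hm₁).trans (iS hm₁ hm₂)) (iS hm₂ hv0)]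
  -- the atom window
  have hI0 : 0 ≤ ∫ β in (n - lam)..(n + lam), montgomeryFormFactor β T :=
    intervalIntegral.integral_nonneg (by linarith) fun x _ ↦ hF0 x
  have hI1 : ∫ β in (n - lam)..(n + lam), montgomeryFormFactor β T ≤ cb + 1 := by
    have := (abs_le.mp h₃).2
    linarith [le_abs_self (c T)]
  have hmod : ∀ x ∈ Icc (n - lam) (n + lam), |g x - g n| ≤ ε₁ := fun x hx ↦
    (hgρ x (by rw [abs_lt]; constructor <;> linarith [hx.1, hx.2])).le
  have hatom := AH.abs_intervalIntegral_mul_sub_le (a := n - lam) (b := n + lam) (by linarith) n (c T)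
    ((RudnickSarnak.continuous_montgomeryFormFactor T).intervalIntegrable _ _) (fun x _ ↦ hF0 x)
    (AH.aestronglyMeasurable_of_ae_continuousWithinAt (ae_continuousWithinAt_mono hcont hm₁ hm₂)) hmod
  have hA₂ : |(∫ α in (n - lam)..(n + lam), montgomeryFormFactor α T * g α) - c T * g n| ≤ η / 2 := by
    calc |(∫ α in (n - lam)..(n + lam), montgomeryFormFactor α T * g α) - c T * g n|
        ≤ ε₁ * (∫ β in (n - lam)..(n + lam), montgomeryFormFactor β T) +
            |g n| * |(∫ β in (n - lam)..(n + lam), montgomeryFormFactor β T) - c T| := hatom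
      _ ≤ ε₁ * (cb + 1) + |g n| * ε₂ := by gcongr
      _ ≤ η / 4 + η / 4 := add_le_add hε₁' hε₂'
      _ = η / 2 := by ring
  have hS₂ : |∫ α in (n - lam)..(n + lam), triangleWave α * g α| ≤ η / 4 :=
    (abs_integral_triangleWave_mul_le hB hm₁ hm₂ (by linarith)).trans (by
      rw [show n + lam - (n - lam) = 2 * lam by ring]; exact hlη')
  -- assemble
  rw [sF, sS]
  calc |(∫ α in u..(n - lam), montgomeryFormFactor α T * g α) +
          (∫ α in (n - lam)..(n + lam), montgomeryFormFactor α T * g α) +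
          (∫ α in (n + lam)..v, montgomeryFormFactor α T * g α) -
        ((∫ α in u..(n - lam), triangleWave α * g α) +
            (∫ α in (n - lam)..(n + lam), triangleWave α * g α) +
            (∫ α in (n + lam)..v, triangleWave α * g α) + c T * g n)|
      = |((∫ α in u..(n - lam), montgomeryFormFactor α T * g α) -
            ∫ α in u..(n - lam), triangleWave α * g α) +
          ((∫ α in (n + lam)..v, montgomeryFormFactor α T * g α) -
            ∫ α in (n + lam)..v, triangleWave α * g α) +
          (((∫ α in (n - lam)..(n + lam), montgomeryFormFactor α T * g α) - c T * g n) +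
            -(∫ α in (n - lam)..(n + lam), triangleWave α * g α))| := by ring_nf
    _ ≤ |(∫ α in u..(n - lam), montgomeryFormFactor α T * g α) -
            ∫ α in u..(n - lam), triangleWave α * g α| +
          |(∫ α in (n + lam)..v, montgomeryFormFactor α T * g α) -
            ∫ α in (n + lam)..v, triangleWave α * g α| +
          (|(∫ α in (n - lam)..(n + lam), montgomeryFormFactor α T * g α) - c T * g n| +
            |-(∫ α in (n - lam)..(n + lam), triangleWave α * g α)|) :=
        (abs_add_le _ _).trans (add_le_add (abs_add_le _ _) (abs_add_le _ _))
    _ < η / 8 + η / 8 + (η / 2 + η / 4) := by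
        rw [abs_neg]
        exact add_lt_add_of_lt_of_le (add_lt_add h₁ h₂) (add_le_add hA₂ hS₂)
    _ = η := by ring


/-! ### Pointwise Lipschitz ⇒ continuity (the printed hypotheses of Theorem 3 imply ours) -/

/-- "Lipschitz continuous at `a`" (BGSTB 2025, §2) implies continuity at `a`.
[cite: BaluyotGoldstonSuriajayaTurnageButterbaugh2025, §2 (before MT-Pairs)] -/
theorem continuousAt_of_isLipschitzAt {g : ℝ → ℝ} {a : ℝ} (h : IsLipschitzAt g a) : ContinuousAt g a := by
  obtain ⟨C, δ, hδ, hC⟩ := h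
  rw [Metric.continuousAt_iff]
  intro ε hε
  refine ⟨min δ (ε / (|C| + 1)), lt_min hδ (by positivity), fun x hx ↦ ?_⟩
  rw [Real.dist_eq] at hx ⊢
  have hxδ : |x - a| < δ := lt_of_lt_of_le hx (min_le_left _ _)
  have hxε : |x - a| ≤ ε / (|C| + 1) := (lt_of_lt_of_le hx (min_le_right _ _)).le
  have e : (|C| + 1) * (ε / (|C| + 1)) = ε := by field_simp
  calc |g x - g a| ≤ C * |x - a| := hC x hxδ
    _ ≤ |C| * |x - a| := mul_le_mul_of_nonneg_right (le_abs_self C) (abs_nonneg _)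
    _ ≤ |C| * (ε / (|C| + 1)) := mul_le_mul_of_nonneg_left hxε (abs_nonneg C)
    _ < (|C| + 1) * (ε / (|C| + 1)) := mul_lt_mul_of_pos_right (lt_add_one _) (by positivity)
    _ = ε := e

/-- "right-Lipschitz continuous at `a`" (BGSTB 2025, §2) implies continuity at `a` within `[a, ∞)`.
[cite: BaluyotGoldstonSuriajayaTurnageButterbaugh2025, §2 (before MT-Pairs)] -/
theorem continuousWithinAt_Ici_of_isRightLipschitzAt {g : ℝ → ℝ} {a : ℝ} (h : IsRightLipschitzAt g a) :
    ContinuousWithinAt g (Ici a) a := by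
  obtain ⟨C, δ, hδ, hC⟩ := h
  rw [Metric.continuousWithinAt_iff]
  intro ε hε
  refine ⟨min δ (ε / (|C| + 1)), lt_min hδ (by positivity), fun x hxa hx ↦ ?_⟩
  rw [Real.dist_eq] at hx ⊢
  rw [mem_Ici] at hxa
  have hxa' : |x - a| = x - a := abs_of_nonneg (sub_nonneg.2 hxa)
  have hxδ : x < a + δ := by linarith [lt_of_lt_of_le hx (min_le_left _ _)]
  have hxε : |x - a| ≤ ε / (|C| + 1) := (lt_of_lt_of_le hx (min_le_right _ _)).le
  have e : (|C| + 1) * (ε / (|C| + 1)) = ε := by field_simp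
  calc |g x - g a| ≤ C * |x - a| := hC x hxa hxδ
    _ ≤ |C| * |x - a| := mul_le_mul_of_nonneg_right (le_abs_self C) (abs_nonneg _)
    _ ≤ |C| * (ε / (|C| + 1)) := mul_le_mul_of_nonneg_left hxε (abs_nonneg C)
    _ < (|C| + 1) * (ε / (|C| + 1)) := mul_lt_mul_of_pos_right (lt_add_one _) (by positivity)
    _ = ε := e

/-- "left-Lipschitz continuous at `a`" (BGSTB 2025, §2) implies continuity at `a` within `(−∞, a]`.
[cite: BaluyotGoldstonSuriajayaTurnageButterbaugh2025, §2 (before MT-Pairs)] -/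
theorem continuousWithinAt_Iic_of_isLeftLipschitzAt {g : ℝ → ℝ} {a : ℝ} (h : IsLeftLipschitzAt g a) :
    ContinuousWithinAt g (Iic a) a := by
  obtain ⟨C, δ, hδ, hC⟩ := h
  rw [Metric.continuousWithinAt_iff]
  intro ε hε
  refine ⟨min δ (ε / (|C| + 1)), lt_min hδ (by positivity), fun x hxa hx ↦ ?_⟩
  rw [Real.dist_eq] at hx ⊢
  rw [mem_Iic] at hxa
  have hxa' : |x - a| = a - x := by rw [abs_sub_comm]; exact abs_of_nonneg (sub_nonneg.2 hxa)
  have hxδ : a - δ < x := by linarith [lt_of_lt_of_le hx (min_le_left _ _)]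
  have hxε : |x - a| ≤ ε / (|C| + 1) := (lt_of_lt_of_le hx (min_le_right _ _)).le
  have e : (|C| + 1) * (ε / (|C| + 1)) = ε := by field_simp
  calc |g x - g a| ≤ C * |x - a| := hC x hxδ hxa
    _ ≤ |C| * |x - a| := mul_le_mul_of_nonneg_right (le_abs_self C) (abs_nonneg _)
    _ ≤ |C| * (ε / (|C| + 1)) := mul_le_mul_of_nonneg_left hxε (abs_nonneg C)
    _ < (|C| + 1) * (ε / (|C| + 1)) := mul_lt_mul_of_pos_right (lt_add_one _) (by positivity)
    _ = ε := e

/-! ### `∫_u^v 𝓕 g` on an interval meeting exactly one mass of `𝓕` -/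

/-- Membership in `Finset.Ioo ⌊u⌋ ⌈v⌉` is `u < m < v`. [folklore] -/
private theorem mem_Ioo_floor_ceil {u v : ℝ} {m : ℤ} : m ∈ Finset.Ioo ⌊u⌋ ⌈v⌉ ↔ u < m ∧ (m : ℝ) < v := by
  rw [Finset.mem_Ioo, Int.floor_lt, Int.lt_ceil]

/-- **`∫_u^v 𝓕 g` across one even atom**: if the only integer point of `[u,v]` is `2L ≠ 0`, `u < 2L < v`, then
`AH.calFIntegral P₀ u v g = ∫_u^v s g + g(2L)` ((calF): "`δ_{2j}(α)`" with unit mass).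
[cite: BaluyotGoldstonSuriajayaTurnageButterbaugh2025, §2 (calF)] -/
theorem calFIntegral_eq_of_single_even (P₀ : ℝ) {u v : ℝ} {L : ℤ} (hL : L ≠ 0) (hun : u < 2 * (L : ℝ))
    (hnv : 2 * (L : ℝ) < v) (hZ : ∀ k : ℤ, (k : ℝ) ∈ Icc u v → (k : ℝ) = 2 * (L : ℝ)) (g : ℝ → ℝ) :
    AH.calFIntegral P₀ u v g = (∫ α in u..v, triangleWave α * g α) + g (2 * (L : ℝ)) := by
  have hZ' : ∀ k : ℤ, (k : ℝ) ∈ Icc u v → k = 2 * L := fun k hk ↦ by exact_mod_cast hZ k hk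
  unfold AH.calFIntegral
  have e1 : (if u < 0 ∧ 0 ≤ v then (1 : ℝ) / 2 else 0) = 0 :=
    if_neg fun h ↦ hL (by have := hZ' 0 ⟨by push_cast; linarith [h.1], by push_cast; exact h.2⟩; omega)
  have e2 : (if u ≤ 0 ∧ 0 < v then (1 : ℝ) / 2 else 0) = 0 :=
    if_neg fun h ↦ hL (by have := hZ' 0 ⟨by push_cast; exact h.1, by push_cast; linarith [h.2]⟩; omega)
  have e3 : (if u ≤ 1 ∧ 1 < v then (1 : ℝ) else 0) = 0 :=
    if_neg fun h ↦ by have := hZ' 1 ⟨by push_cast; exact h.1, by push_cast; linarith [h.2]⟩; omega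
  have e4 : (if u < -1 ∧ -1 ≤ v then (1 : ℝ) else 0) = 0 :=
    if_neg fun h ↦ by have := hZ' (-1) ⟨by push_cast; linarith [h.1], by push_cast; exact h.2⟩; omega
  have s1 : (Finset.Ioo ⌊u⌋ ⌈v⌉).filter (fun m : ℤ ↦ Even m ∧ m ≠ 0) = {2 * L} := by
    ext m
    rw [Finset.mem_filter, mem_Ioo_floor_ceil, Finset.mem_singleton]
    constructor
    · rintro ⟨⟨h1, h2⟩, -⟩
      exact hZ' m ⟨h1.le, h2.le⟩
    · rintro rfl
      push_cast
      exact ⟨⟨hun, hnv⟩, even_two_mul L, by omega⟩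
  have s2 : (Finset.Ioo ⌊u⌋ ⌈v⌉).filter (fun m : ℤ ↦ Odd m ∧ 3 ≤ |m|) = ∅ := by
    refine Finset.eq_empty_iff_forall_notMem.mpr fun m hm ↦ ?_
    rw [Finset.mem_filter, mem_Ioo_floor_ceil] at hm
    obtain ⟨⟨h1, h2⟩, hodd, -⟩ := hm
    have hm2 := hZ' m ⟨h1.le, h2.le⟩
    rw [hm2] at hodd
    exact Int.not_odd_iff_even.mpr (even_two_mul L) hodd
  rw [e1, e2, e3, e4, s1, s2, Finset.sum_singleton]
  push_cast
  simp

/-- **`∫_u^v 𝓕 g` across one odd atom `K`, `|K| ≥ 3`**: if the only integer point of `[u,v]` is `K`, `u < K < v`,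
then `AH.calFIntegral P₀ u v g = ∫_u^v s g + 2(P₀ − 1) g(K)` ((F-delta): mass `2(P_0 − 1)` at the odd integers).
[cite: BaluyotGoldstonSuriajayaTurnageButterbaugh2025, §2 (calF)–(F-delta)] -/
theorem calFIntegral_eq_of_single_odd (P₀ : ℝ) {u v : ℝ} {K : ℤ} (hK : Odd K) (hK3 : 3 ≤ |K|)
    (hun : u < (K : ℝ)) (hnv : (K : ℝ) < v) (hZ : ∀ k : ℤ, (k : ℝ) ∈ Icc u v → (k : ℝ) = (K : ℝ))
    (g : ℝ → ℝ) :
    AH.calFIntegral P₀ u v g = (∫ α in u..v, triangleWave α * g α) + 2 * (P₀ - 1) * g (K : ℝ) := by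
  have hZ' : ∀ k : ℤ, (k : ℝ) ∈ Icc u v → k = K := fun k hk ↦ by exact_mod_cast hZ k hk
  have hK0 : K ≠ 0 := by rintro rfl; simp at hK3
  have hK1 : K ≠ 1 := by rintro rfl; simp at hK3
  have hKm1 : K ≠ -1 := by rintro rfl; simp at hK3
  unfold AH.calFIntegral
  have e1 : (if u < 0 ∧ 0 ≤ v then (1 : ℝ) / 2 else 0) = 0 :=
    if_neg fun h ↦ hK0 (hZ' 0 ⟨by push_cast; linarith [h.1], by push_cast; exact h.2⟩).symm
  have e2 : (if u ≤ 0 ∧ 0 < v then (1 : ℝ) / 2 else 0) = 0 :=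
    if_neg fun h ↦ hK0 (hZ' 0 ⟨by push_cast; exact h.1, by push_cast; linarith [h.2]⟩).symm
  have e3 : (if u ≤ 1 ∧ 1 < v then (1 : ℝ) else 0) = 0 :=
    if_neg fun h ↦ hK1 (hZ' 1 ⟨by push_cast; exact h.1, by push_cast; linarith [h.2]⟩).symm
  have e4 : (if u < -1 ∧ -1 ≤ v then (1 : ℝ) else 0) = 0 :=
    if_neg fun h ↦ hKm1 (hZ' (-1) ⟨by push_cast; linarith [h.1], by push_cast; exact h.2⟩).symm
  have s1 : (Finset.Ioo ⌊u⌋ ⌈v⌉).filter (fun m : ℤ ↦ Even m ∧ m ≠ 0) = ∅ := by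
    refine Finset.eq_empty_iff_forall_notMem.mpr fun m hm ↦ ?_
    rw [Finset.mem_filter, mem_Ioo_floor_ceil] at hm
    obtain ⟨⟨h1, h2⟩, heven, -⟩ := hm
    rw [hZ' m ⟨h1.le, h2.le⟩] at heven
    exact Int.not_even_iff_odd.mpr hK heven
  have s2 : (Finset.Ioo ⌊u⌋ ⌈v⌉).filter (fun m : ℤ ↦ Odd m ∧ 3 ≤ |m|) = {K} := by
    ext m
    rw [Finset.mem_filter, mem_Ioo_floor_ceil, Finset.mem_singleton]
    constructor
    · rintro ⟨⟨h1, h2⟩, -⟩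
      exact hZ' m ⟨h1.le, h2.le⟩
    · rintro rfl
      exact ⟨⟨hun, hnv⟩, hK, hK3⟩
  rw [e1, e2, e3, e4, s1, s2, Finset.sum_singleton]
  simp

/-- **`∫_1^v 𝓕 g` to the right of `1`**: if the only integer point of `[1,v]` is `1` and `1 < v`, then
`AH.calFIntegral P₀ 1 v g = ∫_1^v s g + 2(P₀ − 1) g(1)` ((calF): the one-sided mass `δ_1^+`, with the
coefficient `2(P_0 − 1)` of (F-delta)). [cite: BaluyotGoldstonSuriajayaTurnageButterbaugh2025, §2 (calF)–(F-delta)] -/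
theorem calFIntegral_eq_of_right_one (P₀ : ℝ) {v : ℝ} (hv : 1 < v)
    (hZ : ∀ k : ℤ, (k : ℝ) ∈ Icc (1 : ℝ) v → (k : ℝ) = 1) (g : ℝ → ℝ) :
    AH.calFIntegral P₀ 1 v g = (∫ α in (1 : ℝ)..v, triangleWave α * g α) + 2 * (P₀ - 1) * g 1 := by
  have hZ' : ∀ k : ℤ, (k : ℝ) ∈ Icc (1 : ℝ) v → k = 1 := fun k hk ↦ by exact_mod_cast hZ k hk
  unfold AH.calFIntegral
  have e1 : (if (1 : ℝ) < 0 ∧ 0 ≤ v then (1 : ℝ) / 2 else 0) = 0 := if_neg fun h ↦ by linarith [h.1]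
  have e2 : (if (1 : ℝ) ≤ 0 ∧ 0 < v then (1 : ℝ) / 2 else 0) = 0 := if_neg fun h ↦ by linarith [h.1]
  have e3 : (if (1 : ℝ) ≤ 1 ∧ 1 < v then (1 : ℝ) else 0) = 1 := if_pos ⟨le_rfl, hv⟩
  have e4 : (if (1 : ℝ) < -1 ∧ -1 ≤ v then (1 : ℝ) else 0) = 0 := if_neg fun h ↦ by linarith [h.1]
  have hI : Finset.Ioo ⌊(1 : ℝ)⌋ ⌈v⌉ = ∅ := by
    refine Finset.eq_empty_iff_forall_notMem.mpr fun m hm ↦ ?_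
    rw [mem_Ioo_floor_ceil] at hm
    have := hZ' m ⟨hm.1.le, hm.2.le⟩
    rw [this] at hm
    simp at hm
  rw [e1, e2, e3, e4, hI]
  simp

/-- **`∫_u^{−1} 𝓕 g` to the left of `−1`**: if the only integer point of `[u,−1]` is `−1` and `u < −1`, then
`AH.calFIntegral P₀ u (−1) g = ∫_u^{−1} s g + 2(P₀ − 1) g(−1)` ((calF): the one-sided mass `δ_{−1}^−`).
[cite: BaluyotGoldstonSuriajayaTurnageButterbaugh2025, §2 (calF)–(F-delta)] -/
theorem calFIntegral_eq_of_left_negOne (P₀ : ℝ) {u : ℝ} (hu : u < -1)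
    (hZ : ∀ k : ℤ, (k : ℝ) ∈ Icc u (-1 : ℝ) → (k : ℝ) = -1) (g : ℝ → ℝ) :
    AH.calFIntegral P₀ u (-1) g = (∫ α in u..(-1 : ℝ), triangleWave α * g α) + 2 * (P₀ - 1) * g (-1) := by
  have hZ' : ∀ k : ℤ, (k : ℝ) ∈ Icc u (-1 : ℝ) → k = -1 := fun k hk ↦ by exact_mod_cast hZ k hk
  unfold AH.calFIntegral
  have e1 : (if u < 0 ∧ (0 : ℝ) ≤ -1 then (1 : ℝ) / 2 else 0) = 0 := if_neg fun h ↦ by linarith [h.2]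
  have e2 : (if u ≤ 0 ∧ (0 : ℝ) < -1 then (1 : ℝ) / 2 else 0) = 0 := if_neg fun h ↦ by linarith [h.2]
  have e3 : (if u ≤ 1 ∧ (1 : ℝ) < -1 then (1 : ℝ) else 0) = 0 := if_neg fun h ↦ by linarith [h.2]
  have e4 : (if u < -1 ∧ (-1 : ℝ) ≤ -1 then (1 : ℝ) else 0) = 1 := if_pos ⟨hu, le_rfl⟩
  have hI : Finset.Ioo ⌊u⌋ ⌈(-1 : ℝ)⌉ = ∅ := by
    refine Finset.eq_empty_iff_forall_notMem.mpr fun m hm ↦ ?_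
    rw [mem_Ioo_floor_ceil] at hm
    have := hZ' m ⟨hm.1.le, hm.2.le⟩
    rw [this] at hm
    simp at hm
  rw [e1, e2, e3, e4, hI]
  simp

/-! ### (W-P) is a theorem: the diagonal-bin density is eventually bounded under RH -/

/-- **`P_0(T) = O(1)` under RH** (the bound behind "`|𝒫(T,M)| ≪ M T log T`", BGSTB 2025, §3 (P-bound), via
the tree's pair-window count `RudnickSarnak.exists_pairCount_window_le` and `AH.card_pairs_le_window`):
for every `M`, `δ` there is `P` with `|AH.binDensity 0 T M δ| ≤ P` for all large `T`.
[cite: BaluyotGoldstonSuriajayaTurnageButterbaugh2025, §3 (P-bound)] -/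
theorem exists_abs_binDensity_le (hRH : RiemannHypothesis) (M δ : ℝ) :
    ∃ P : ℝ, ∀ᶠ T : ℝ in atTop, |AH.binDensity 0 T M δ| ≤ P := by
  obtain ⟨y₀, hy₀, C_w, hwin⟩ := RudnickSarnak.exists_pairCount_window_le hRH
  refine ⟨4 * π * |C_w| * (⌊|M| / y₀⌋₊ + 1), ?_⟩
  filter_upwards [hwin, eventually_gt_atTop (1 : ℝ),
    Real.tendsto_log_atTop.eventually_ge_atTop (π * ((|M| / y₀ + 5 / 2) * y₀))] with T hwinT hT1 hlog
  have hL : 0 < Real.log T := Real.log_pos hT1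
  have hT0 : 0 < T := by linarith
  have hden : 0 < T / (2 * π) * Real.log T := by positivity
  have hL' : (|M| / y₀ + 5 / 2) * y₀ ≤ Real.log T / π := by
    rw [le_div_iff₀ Real.pi_pos]
    linarith [mul_comm π ((|M| / y₀ + 5 / 2) * y₀)]
  have hcard : ((AH.bin 0 T M δ).card : ℝ) ≤ 2 * (C_w * (T * Real.log T)) * (⌊|M| / y₀⌋₊ + 1) :=
    calc ((AH.bin 0 T M δ).card : ℝ) ≤ (AH.pairs T |M|).card := by
          exact_mod_cast Finset.card_le_card
            ((AH.bin_subset_pairs 0 T M δ).trans (AH.pairs_mono (le_abs_self M)))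
      _ ≤ _ := AH.card_pairs_le_window (abs_nonneg M) hy₀ hwinT hL'
  unfold AH.binDensity
  rw [abs_of_nonneg (div_nonneg (Nat.cast_nonneg _) hden.le), div_le_iff₀ hden]
  calc ((AH.bin 0 T M δ).card : ℝ) ≤ 2 * (C_w * (T * Real.log T)) * (⌊|M| / y₀⌋₊ + 1) := hcard
    _ ≤ 2 * (|C_w| * (T * Real.log T)) * (⌊|M| / y₀⌋₊ + 1) := by gcongr; exact le_abs_self _
    _ = 4 * π * |C_w| * (⌊|M| / y₀⌋₊ + 1) * (T / (2 * π) * Real.log T) := by field_simp; ring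

/-! ### Theorem 3 across one even atom and across one odd atom -/

/-- **BGSTB 2025, Theorem 3 across one even atom `2L ≠ 0`** (§7: "`∫_{2L−λ}^{2L+λ} F(α) dα = 1 + o(1)
∼ ∫_{2L−λ}^{2L+λ} δ_{2L}(α) dα ∼ ∫_{2L−λ}^{2L+λ} 𝓕(α) dα`" and "Next consider a function `g(α)` which is
Lipschitz continuous at `α = N ∈ ℤ` …"). Our composition in limit form: from (W-ii) and (W-even) at `L`
(`|∫_{2L−λ}^{2L+λ} F(β,T) dβ − 1| ≤ ε` for all small `λ`, eventually in `T`), on `[u,v]` whose only integer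
point is `2L`, for `g` bounded, a.e.-continuous within `[u,v]` and continuous at `2L` (implied by the printed
Lipschitz condition, `continuousAt_of_isLipschitzAt`): `∫_u^v F g − AH.calFIntegral (P₀ T) u v g → 0`, every `P₀`.
[cite: BaluyotGoldstonSuriajayaTurnageButterbaugh2025, §7 (proof of Theorem 3)] -/
theorem tendsto_sub_calFIntegral_of_even
    (hWii : ∀ K : ℝ, ∀ ε > 0, ∃ lam0 > 0, ∀ lam : ℝ, 0 < lam → lam ≤ lam0 → ∀ᶠ T : ℝ in atTop,
      ∀ α : ℝ, |α| ≤ K → (∀ n : ℤ, 2 * lam ≤ |α - n|) →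
        |1 / (2 * lam) * (∫ β in (α - lam)..(α + lam), montgomeryFormFactor β T) - triangleWave α| ≤ ε)
    {L : ℤ} (hL : L ≠ 0)
    (hWe : ∀ ε > 0, ∃ lam0 > 0, ∀ lam : ℝ, 0 < lam → lam ≤ lam0 → ∀ᶠ T : ℝ in atTop,
      |(∫ β in (2 * (L : ℝ) - lam)..(2 * (L : ℝ) + lam), montgomeryFormFactor β T) - 1| ≤ ε)
    {u v : ℝ} (hun : u < 2 * (L : ℝ)) (hnv : 2 * (L : ℝ) < v)
    (hZ : ∀ k : ℤ, (k : ℝ) ∈ Icc u v → (k : ℝ) = 2 * (L : ℝ)) {g : ℝ → ℝ}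
    (hbdd : ∃ B : ℝ, ∀ x ∈ Icc u v, |g x| ≤ B)
    (hcont : ∀ᵐ x ∂(volume.restrict (Icc u v)), ContinuousWithinAt g (Icc u v) x)
    (hg : ContinuousAt g (2 * (L : ℝ))) (P₀ : ℝ → ℝ) :
    Tendsto (fun T : ℝ ↦ (∫ α in u..v, montgomeryFormFactor α T * g α) -
      AH.calFIntegral (P₀ T) u v g) atTop (𝓝 0) := by
  obtain ⟨B, hB⟩ := hbdd
  have h := tendsto_sub_of_atom hWii hun hnv hZ hB hcont hg (c := fun _ ↦ (1 : ℝ))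
    ⟨1, Eventually.of_forall fun _ ↦ by simp⟩ hWe
  refine h.congr fun T ↦ ?_
  rw [calFIntegral_eq_of_single_even (P₀ T) hL hun hnv hZ g, one_mul]

/-- **BGSTB 2025, Theorem 3 across one odd atom `K`, `|K| ≥ 3`** (§7: "and similarly with `K = 2L+1`
`∫_{K−λ}^{K+λ} F(α) dα = 2(P_0−1) + o(1) ∼ 2(P_0−1) ∫_{K−λ}^{K+λ} δ_K(α) dα ∼ ∫_{K−λ}^{K+λ} 𝓕(α) dα`").
Our composition in limit form: from (W-ii) and the two-sided odd-window input (W-odd) at `K` for the level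
`M`, `δ` (`|∫_{K−λ}^{K+λ} F(β,T) dβ − 2(P_0(T) − 1)| ≤ ε` for all small `λ`, eventually in `T`,
`P_0(T) = AH.binDensity 0 T M δ`), on `[u,v]` whose only integer point is `K`, for `g` bounded, a.e.-continuous
within `[u,v]` and continuous at `K`: `∫_u^v F g − AH.calFIntegral (AH.binDensity 0 T M δ) u v g → 0`.
RH enters only through the boundedness of `P_0(T)` (`exists_abs_binDensity_le`).
[cite: BaluyotGoldstonSuriajayaTurnageButterbaugh2025, §7 (proof of Theorem 3)] -/
theorem tendsto_sub_calFIntegral_of_odd (hRH : RiemannHypothesis)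
    (hWii : ∀ K : ℝ, ∀ ε > 0, ∃ lam0 > 0, ∀ lam : ℝ, 0 < lam → lam ≤ lam0 → ∀ᶠ T : ℝ in atTop,
      ∀ α : ℝ, |α| ≤ K → (∀ n : ℤ, 2 * lam ≤ |α - n|) →
        |1 / (2 * lam) * (∫ β in (α - lam)..(α + lam), montgomeryFormFactor β T) - triangleWave α| ≤ ε)
    {K : ℤ} (hK : Odd K) (hK3 : 3 ≤ |K|) {M δ : ℝ}
    (hWo : ∀ ε > 0, ∃ lam0 > 0, ∀ lam : ℝ, 0 < lam → lam ≤ lam0 → ∀ᶠ T : ℝ in atTop,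
      |(∫ β in ((K : ℝ) - lam)..((K : ℝ) + lam), montgomeryFormFactor β T) -
        2 * (AH.binDensity 0 T M δ - 1)| ≤ ε)
    {u v : ℝ} (hun : u < (K : ℝ)) (hnv : (K : ℝ) < v)
    (hZ : ∀ k : ℤ, (k : ℝ) ∈ Icc u v → (k : ℝ) = (K : ℝ)) {g : ℝ → ℝ}
    (hbdd : ∃ B : ℝ, ∀ x ∈ Icc u v, |g x| ≤ B)
    (hcont : ∀ᵐ x ∂(volume.restrict (Icc u v)), ContinuousWithinAt g (Icc u v) x)
    (hg : ContinuousAt g (K : ℝ)) :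
    Tendsto (fun T : ℝ ↦ (∫ α in u..v, montgomeryFormFactor α T * g α) -
      AH.calFIntegral (AH.binDensity 0 T M δ) u v g) atTop (𝓝 0) := by
  obtain ⟨B, hB⟩ := hbdd
  obtain ⟨P, hP⟩ := exists_abs_binDensity_le hRH M δ
  have hcb : ∃ cb : ℝ, ∀ᶠ T : ℝ in atTop, |2 * (AH.binDensity 0 T M δ - 1)| ≤ cb := by
    refine ⟨2 * (P + 1), ?_⟩
    filter_upwards [hP] with T hT
    rw [abs_mul, abs_two]
    have := abs_sub (AH.binDensity 0 T M δ) 1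
    rw [abs_one] at this
    linarith
  have h := tendsto_sub_of_atom hWii hun hnv hZ hB hcont hg
    (c := fun T ↦ 2 * (AH.binDensity 0 T M δ - 1)) hcb hWo
  refine h.congr fun T ↦ ?_
  rw [calFIntegral_eq_of_single_odd _ hK hK3 hun hnv hZ g]


/-! ### One-sided atoms at an endpoint of the interval -/

/-- **The window at a LEFT endpoint atom, one-sided** (BGSTB 2025, §7: "and the corresponding one-sided results
hold when `N = 0, ±1`"). Our composition in limit form: on `[n, v]` whose only integer point (if any) is the
left endpoint `n`, with `g` bounded on `[n,v]`, a.e.-continuous within `[n,v]` and continuous at `n` from the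
right, given (W-ii) and the one-sided mass input `|∫_n^{n+λ} F(β,T) dβ − c(T)| ≤ ε` (all small `λ`,
eventually in `T`; `c` eventually bounded): `∫_n^v F g − (∫_n^v s g + c(T) g(n)) → 0`.
[cite: BaluyotGoldstonSuriajayaTurnageButterbaugh2025, §7 (proof of Theorem 3)] -/
theorem tendsto_sub_of_atom_right
    (hWii : ∀ K : ℝ, ∀ ε > 0, ∃ lam0 > 0, ∀ lam : ℝ, 0 < lam → lam ≤ lam0 → ∀ᶠ T : ℝ in atTop,
      ∀ α : ℝ, |α| ≤ K → (∀ n : ℤ, 2 * lam ≤ |α - n|) →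
        |1 / (2 * lam) * (∫ β in (α - lam)..(α + lam), montgomeryFormFactor β T) - triangleWave α| ≤ ε)
    {v n : ℝ} (hnv : n < v) (hZ : ∀ k : ℤ, (k : ℝ) ∈ Icc n v → (k : ℝ) = n)
    {g : ℝ → ℝ} {B : ℝ} (hB : ∀ x ∈ Icc n v, |g x| ≤ B)
    (hcont : ∀ᵐ x ∂(volume.restrict (Icc n v)), ContinuousWithinAt g (Icc n v) x)
    (hgn : ContinuousWithinAt g (Ici n) n) {c : ℝ → ℝ} (hcb : ∃ cb : ℝ, ∀ᶠ T : ℝ in atTop, |c T| ≤ cb)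
    (hWn : ∀ ε > 0, ∃ lam0 > 0, ∀ lam : ℝ, 0 < lam → lam ≤ lam0 → ∀ᶠ T : ℝ in atTop,
      |(∫ β in n..(n + lam), montgomeryFormFactor β T) - c T| ≤ ε) :
    Tendsto (fun T : ℝ ↦ (∫ α in n..v, montgomeryFormFactor α T * g α) -
      ((∫ α in n..v, triangleWave α * g α) + c T * g n)) atTop (𝓝 0) := by
  obtain ⟨cb, hcbT⟩ := hcb
  obtain ⟨T₁, hT₁⟩ := hcbT.exists
  have hcb0 : 0 ≤ cb := (abs_nonneg _).trans hT₁
  have huv : n ≤ v := hnv.le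
  have hB0 : 0 ≤ B := (abs_nonneg _).trans (hB n (left_mem_Icc.2 huv))
  have hgm : AEStronglyMeasurable g (volume.restrict (Icc n v)) :=
    AH.aestronglyMeasurable_of_ae_continuousWithinAt hcont
  rw [Metric.tendsto_nhds]
  intro η hη
  set ε₁ : ℝ := η / (4 * (cb + 2)) with hε₁_def
  have hε₁ : 0 < ε₁ := by positivity
  have hε₁' : ε₁ * (cb + 1) ≤ η / 4 := by
    have e : ε₁ * (cb + 2) = η / 4 := by rw [hε₁_def]; field_simp
    nlinarith
  obtain ⟨ρ, hρ, hgρ⟩ : ∃ ρ > 0, ∀ x : ℝ, n ≤ x → |x - n| < ρ → |g x - g n| < ε₁ := by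
    obtain ⟨ρ, hρ, h⟩ := Metric.continuousWithinAt_iff.mp hgn ε₁ hε₁
    exact ⟨ρ, hρ, fun x hxn hx ↦ by
      simpa [Real.dist_eq] using h (mem_Ici.2 hxn) (by simpa [Real.dist_eq] using hx)⟩
  set ε₂ : ℝ := min 1 (η / (4 * (|g n| + 1))) with hε₂_def
  have hε₂ : 0 < ε₂ := by positivity
  have hε₂1 : ε₂ ≤ 1 := min_le_left _ _
  have hε₂' : |g n| * ε₂ ≤ η / 4 := by
    have e : (|g n| + 1) * (η / (4 * (|g n| + 1))) = η / 4 := by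
      rw [mul_comm, div_mul_eq_mul_div, mul_div_mul_right _ _ (by positivity : (|g n| + 1) ≠ 0)]
    have h1 : |g n| * ε₂ ≤ |g n| * (η / (4 * (|g n| + 1))) :=
      mul_le_mul_of_nonneg_left (min_le_right _ _) (abs_nonneg _)
    have h2 : |g n| * (η / (4 * (|g n| + 1))) ≤ (|g n| + 1) * (η / (4 * (|g n| + 1))) :=
      mul_le_mul_of_nonneg_right (by linarith) (by positivity)
    linarith
  obtain ⟨lam0, hlam0, hW⟩ := hWn ε₂ hε₂
  set lam : ℝ := min (min lam0 (ρ / 2)) (min ((v - n) / 2) (η / (8 * (B + 1)))) with hlam_def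
  have hlam : 0 < lam := by
    rw [hlam_def]
    refine lt_min (lt_min hlam0 (by positivity)) (lt_min ?_ (by positivity)); linarith
  have hl0 : lam ≤ lam0 := (min_le_left _ _).trans (min_le_left _ _)
  have hlρ : lam ≤ ρ / 2 := (min_le_left _ _).trans (min_le_right _ _)
  have hlv : lam ≤ (v - n) / 2 := (min_le_right _ _).trans (min_le_left _ _)
  have hlη : lam ≤ η / (8 * (B + 1)) := (min_le_right _ _).trans (min_le_right _ _)
  have hlη' : B * lam ≤ η / 4 := by
    have e : (B + 1) * (2 * (η / (8 * (B + 1)))) = η / 4 := by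
      rw [show (B + 1) * (2 * (η / (8 * (B + 1)))) = (2 * η) * (B + 1) / (8 * (B + 1)) by ring,
        mul_div_mul_right _ _ (by positivity : (B + 1) ≠ 0)]
      ring
    have h1 : B * lam ≤ B * (2 * (η / (8 * (B + 1)))) := by
      refine mul_le_mul_of_nonneg_left ?_ hB0; linarith
    have h2 : B * (2 * (η / (8 * (B + 1)))) ≤ (B + 1) * (2 * (η / (8 * (B + 1)))) :=
      mul_le_mul_of_nonneg_right (by linarith) (by positivity)
    linarith
  have hv' : n + lam ≤ v := by linarith
  have hm₂ : n + lam ∈ Icc n v := ⟨by linarith, hv'⟩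
  have hZ₂ : ∀ k : ℤ, (k : ℝ) ∉ Icc (n + lam) v := fun k hk ↦ by
    have := hZ k ⟨le_trans (by linarith) hk.1, hk.2⟩; linarith [hk.1]
  have hfl₂ := tendsto_sub_calFIntegral_of_intFree hWii hv' hZ₂
    ⟨B, fun x hx ↦ hB x ⟨hm₂.1.trans hx.1, hx.2⟩⟩
    (ae_continuousWithinAt_mono hcont hm₂ (right_mem_Icc.2 huv)) (fun _ ↦ 0)
  simp_rw [calFIntegral_eq_of_intFree _ hZ₂] at hfl₂
  have e₂ := Metric.tendsto_nhds.mp hfl₂ (η / 8) (by positivity)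
  filter_upwards [e₂, hW lam hlam hl0, hcbT, eventually_gt_atTop (1 : ℝ)] with T h₂ h₃ hcT hT1
  rw [Real.dist_eq, sub_zero] at h₂ ⊢
  have hF0 : ∀ x, 0 ≤ montgomeryFormFactor x T := fun x ↦ Montgomery.montgomeryFormFactor_nonneg x hT1
  have hu0 : n ∈ Icc n v := left_mem_Icc.2 huv
  have hv0 : v ∈ Icc n v := right_mem_Icc.2 huv
  have sF : ∫ α in n..v, montgomeryFormFactor α T * g α =
      (∫ α in n..(n + lam), montgomeryFormFactor α T * g α) +
        ∫ α in (n + lam)..v, montgomeryFormFactor α T * g α := by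
    rw [intervalIntegral.integral_add_adjacent_intervals
      (intervalIntegrable_formFactor_mul hB hgm hu0 hm₂ T) (intervalIntegrable_formFactor_mul hB hgm hm₂ hv0 T)]
  have sS : ∫ α in n..v, triangleWave α * g α =
      (∫ α in n..(n + lam), triangleWave α * g α) + ∫ α in (n + lam)..v, triangleWave α * g α := by
    rw [intervalIntegral.integral_add_adjacent_intervals
      (intervalIntegrable_triangleWave_mul hB hgm hu0 hm₂) (intervalIntegrable_triangleWave_mul hB hgm hm₂ hv0)]
  have hI1 : ∫ β in n..(n + lam), montgomeryFormFactor β T ≤ cb + 1 := by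
    have := (abs_le.mp h₃).2
    linarith [le_abs_self (c T)]
  have hmod : ∀ x ∈ Icc n (n + lam), |g x - g n| ≤ ε₁ := fun x hx ↦
    (hgρ x hx.1 (by rw [abs_lt]; constructor <;> linarith [hx.1, hx.2])).le
  have hatom := AH.abs_intervalIntegral_mul_sub_le (a := n) (b := n + lam) (by linarith) n (c T)
    ((RudnickSarnak.continuous_montgomeryFormFactor T).intervalIntegrable _ _) (fun x _ ↦ hF0 x)
    (AH.aestronglyMeasurable_of_ae_continuousWithinAt (ae_continuousWithinAt_mono hcont hu0 hm₂)) hmod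
  have hA₂ : |(∫ α in n..(n + lam), montgomeryFormFactor α T * g α) - c T * g n| ≤ η / 2 := by
    calc |(∫ α in n..(n + lam), montgomeryFormFactor α T * g α) - c T * g n|
        ≤ ε₁ * (∫ β in n..(n + lam), montgomeryFormFactor β T) +
            |g n| * |(∫ β in n..(n + lam), montgomeryFormFactor β T) - c T| := hatom
      _ ≤ ε₁ * (cb + 1) + |g n| * ε₂ := by gcongr
      _ ≤ η / 4 + η / 4 := add_le_add hε₁' hε₂'
      _ = η / 2 := by ring
  have hS₂ : |∫ α in n..(n + lam), triangleWave α * g α| ≤ η / 4 :=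
    (abs_integral_triangleWave_mul_le hB hu0 hm₂ (by linarith)).trans (by
      rw [show n + lam - n = lam by ring]; exact hlη')
  rw [sF, sS]
  calc |(∫ α in n..(n + lam), montgomeryFormFactor α T * g α) +
          (∫ α in (n + lam)..v, montgomeryFormFactor α T * g α) -
        ((∫ α in n..(n + lam), triangleWave α * g α) +
            (∫ α in (n + lam)..v, triangleWave α * g α) + c T * g n)|
      = |((∫ α in (n + lam)..v, montgomeryFormFactor α T * g α) -
            ∫ α in (n + lam)..v, triangleWave α * g α) +
          (((∫ α in n..(n + lam), montgomeryFormFactor α T * g α) - c T * g n) +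
            -(∫ α in n..(n + lam), triangleWave α * g α))| := by ring_nf
    _ ≤ |(∫ α in (n + lam)..v, montgomeryFormFactor α T * g α) -
            ∫ α in (n + lam)..v, triangleWave α * g α| +
          (|(∫ α in n..(n + lam), montgomeryFormFactor α T * g α) - c T * g n| +
            |-(∫ α in n..(n + lam), triangleWave α * g α)|) :=
        (abs_add_le _ _).trans (add_le_add le_rfl (abs_add_le _ _))
    _ < η / 8 + (η / 2 + η / 4) := by
        rw [abs_neg]
        exact add_lt_add_of_lt_of_le h₂ (add_le_add hA₂ hS₂)
    _ ≤ η := by linarith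

/-- **The window at a RIGHT endpoint atom, one-sided** (mirror image of `tendsto_sub_of_atom_right`): on
`[u, n]` whose only integer point (if any) is the right endpoint `n`, with `g` bounded on `[u,n]`,
a.e.-continuous within `[u,n]` and continuous at `n` from the left, given (W-ii) and the one-sided mass
input `|∫_{n−λ}^{n} F(β,T) dβ − c(T)| ≤ ε`: `∫_u^n F g − (∫_u^n s g + c(T) g(n)) → 0`.
[cite: BaluyotGoldstonSuriajayaTurnageButterbaugh2025, §7 (proof of Theorem 3)] -/
theorem tendsto_sub_of_atom_left
    (hWii : ∀ K : ℝ, ∀ ε > 0, ∃ lam0 > 0, ∀ lam : ℝ, 0 < lam → lam ≤ lam0 → ∀ᶠ T : ℝ in atTop,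
      ∀ α : ℝ, |α| ≤ K → (∀ n : ℤ, 2 * lam ≤ |α - n|) →
        |1 / (2 * lam) * (∫ β in (α - lam)..(α + lam), montgomeryFormFactor β T) - triangleWave α| ≤ ε)
    {u n : ℝ} (hun : u < n) (hZ : ∀ k : ℤ, (k : ℝ) ∈ Icc u n → (k : ℝ) = n)
    {g : ℝ → ℝ} {B : ℝ} (hB : ∀ x ∈ Icc u n, |g x| ≤ B)
    (hcont : ∀ᵐ x ∂(volume.restrict (Icc u n)), ContinuousWithinAt g (Icc u n) x)
    (hgn : ContinuousWithinAt g (Iic n) n) {c : ℝ → ℝ} (hcb : ∃ cb : ℝ, ∀ᶠ T : ℝ in atTop, |c T| ≤ cb)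
    (hWn : ∀ ε > 0, ∃ lam0 > 0, ∀ lam : ℝ, 0 < lam → lam ≤ lam0 → ∀ᶠ T : ℝ in atTop,
      |(∫ β in (n - lam)..n, montgomeryFormFactor β T) - c T| ≤ ε) :
    Tendsto (fun T : ℝ ↦ (∫ α in u..n, montgomeryFormFactor α T * g α) -
      ((∫ α in u..n, triangleWave α * g α) + c T * g n)) atTop (𝓝 0) := by
  obtain ⟨cb, hcbT⟩ := hcb
  obtain ⟨T₁, hT₁⟩ := hcbT.exists
  have hcb0 : 0 ≤ cb := (abs_nonneg _).trans hT₁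
  have huv : u ≤ n := hun.le
  have hB0 : 0 ≤ B := (abs_nonneg _).trans (hB u (left_mem_Icc.2 huv))
  have hgm : AEStronglyMeasurable g (volume.restrict (Icc u n)) :=
    AH.aestronglyMeasurable_of_ae_continuousWithinAt hcont
  rw [Metric.tendsto_nhds]
  intro η hη
  set ε₁ : ℝ := η / (4 * (cb + 2)) with hε₁_def
  have hε₁ : 0 < ε₁ := by positivity
  have hε₁' : ε₁ * (cb + 1) ≤ η / 4 := by
    have e : ε₁ * (cb + 2) = η / 4 := by rw [hε₁_def]; field_simp
    nlinarith
  obtain ⟨ρ, hρ, hgρ⟩ : ∃ ρ > 0, ∀ x : ℝ, x ≤ n → |x - n| < ρ → |g x - g n| < ε₁ := by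
    obtain ⟨ρ, hρ, h⟩ := Metric.continuousWithinAt_iff.mp hgn ε₁ hε₁
    exact ⟨ρ, hρ, fun x hxn hx ↦ by
      simpa [Real.dist_eq] using h (mem_Iic.2 hxn) (by simpa [Real.dist_eq] using hx)⟩
  set ε₂ : ℝ := min 1 (η / (4 * (|g n| + 1))) with hε₂_def
  have hε₂ : 0 < ε₂ := by positivity
  have hε₂1 : ε₂ ≤ 1 := min_le_left _ _
  have hε₂' : |g n| * ε₂ ≤ η / 4 := by
    have e : (|g n| + 1) * (η / (4 * (|g n| + 1))) = η / 4 := by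
      rw [mul_comm, div_mul_eq_mul_div, mul_div_mul_right _ _ (by positivity : (|g n| + 1) ≠ 0)]
    have h1 : |g n| * ε₂ ≤ |g n| * (η / (4 * (|g n| + 1))) :=
      mul_le_mul_of_nonneg_left (min_le_right _ _) (abs_nonneg _)
    have h2 : |g n| * (η / (4 * (|g n| + 1))) ≤ (|g n| + 1) * (η / (4 * (|g n| + 1))) :=
      mul_le_mul_of_nonneg_right (by linarith) (by positivity)
    linarith
  obtain ⟨lam0, hlam0, hW⟩ := hWn ε₂ hε₂
  set lam : ℝ := min (min lam0 (ρ / 2)) (min ((n - u) / 2) (η / (8 * (B + 1)))) with hlam_def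
  have hlam : 0 < lam := by
    rw [hlam_def]
    refine lt_min (lt_min hlam0 (by positivity)) (lt_min ?_ (by positivity)); linarith
  have hl0 : lam ≤ lam0 := (min_le_left _ _).trans (min_le_left _ _)
  have hlρ : lam ≤ ρ / 2 := (min_le_left _ _).trans (min_le_right _ _)
  have hlu : lam ≤ (n - u) / 2 := (min_le_right _ _).trans (min_le_left _ _)
  have hlη : lam ≤ η / (8 * (B + 1)) := (min_le_right _ _).trans (min_le_right _ _)
  have hlη' : B * lam ≤ η / 4 := by
    have e : (B + 1) * (2 * (η / (8 * (B + 1)))) = η / 4 := by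
      rw [show (B + 1) * (2 * (η / (8 * (B + 1)))) = (2 * η) * (B + 1) / (8 * (B + 1)) by ring,
        mul_div_mul_right _ _ (by positivity : (B + 1) ≠ 0)]
      ring
    have h1 : B * lam ≤ B * (2 * (η / (8 * (B + 1)))) := by
      refine mul_le_mul_of_nonneg_left ?_ hB0; linarith
    have h2 : B * (2 * (η / (8 * (B + 1)))) ≤ (B + 1) * (2 * (η / (8 * (B + 1)))) :=
      mul_le_mul_of_nonneg_right (by linarith) (by positivity)
    linarith
  have hu' : u ≤ n - lam := by linarith
  have hm₁ : n - lam ∈ Icc u n := ⟨hu', by linarith⟩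
  have hZ₁ : ∀ k : ℤ, (k : ℝ) ∉ Icc u (n - lam) := fun k hk ↦ by
    have := hZ k ⟨hk.1, hk.2.trans (by linarith)⟩; linarith [hk.2]
  have hfl₁ := tendsto_sub_calFIntegral_of_intFree hWii hu' hZ₁
    ⟨B, fun x hx ↦ hB x ⟨hx.1, hx.2.trans hm₁.2⟩⟩
    (ae_continuousWithinAt_mono hcont (left_mem_Icc.2 huv) hm₁) (fun _ ↦ 0)
  simp_rw [calFIntegral_eq_of_intFree _ hZ₁] at hfl₁
  have e₁ := Metric.tendsto_nhds.mp hfl₁ (η / 8) (by positivity)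
  filter_upwards [e₁, hW lam hlam hl0, hcbT, eventually_gt_atTop (1 : ℝ)] with T h₁ h₃ hcT hT1
  rw [Real.dist_eq, sub_zero] at h₁ ⊢
  have hF0 : ∀ x, 0 ≤ montgomeryFormFactor x T := fun x ↦ Montgomery.montgomeryFormFactor_nonneg x hT1
  have hu0 : u ∈ Icc u n := left_mem_Icc.2 huv
  have hv0 : n ∈ Icc u n := right_mem_Icc.2 huv
  have sF : ∫ α in u..n, montgomeryFormFactor α T * g α =
      (∫ α in u..(n - lam), montgomeryFormFactor α T * g α) +
        ∫ α in (n - lam)..n, montgomeryFormFactor α T * g α := by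
    rw [intervalIntegral.integral_add_adjacent_intervals
      (intervalIntegrable_formFactor_mul hB hgm hu0 hm₁ T) (intervalIntegrable_formFactor_mul hB hgm hm₁ hv0 T)]
  have sS : ∫ α in u..n, triangleWave α * g α =
      (∫ α in u..(n - lam), triangleWave α * g α) + ∫ α in (n - lam)..n, triangleWave α * g α := by
    rw [intervalIntegral.integral_add_adjacent_intervals
      (intervalIntegrable_triangleWave_mul hB hgm hu0 hm₁) (intervalIntegrable_triangleWave_mul hB hgm hm₁ hv0)]
  have hI1 : ∫ β in (n - lam)..n, montgomeryFormFactor β T ≤ cb + 1 := by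
    have := (abs_le.mp h₃).2
    linarith [le_abs_self (c T)]
  have hmod : ∀ x ∈ Icc (n - lam) n, |g x - g n| ≤ ε₁ := fun x hx ↦
    (hgρ x hx.2 (by rw [abs_lt]; constructor <;> linarith [hx.1, hx.2])).le
  have hatom := AH.abs_intervalIntegral_mul_sub_le (a := n - lam) (b := n) (by linarith) n (c T)
    ((RudnickSarnak.continuous_montgomeryFormFactor T).intervalIntegrable _ _) (fun x _ ↦ hF0 x)
    (AH.aestronglyMeasurable_of_ae_continuousWithinAt (ae_continuousWithinAt_mono hcont hm₁ hv0)) hmod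
  have hA₂ : |(∫ α in (n - lam)..n, montgomeryFormFactor α T * g α) - c T * g n| ≤ η / 2 := by
    calc |(∫ α in (n - lam)..n, montgomeryFormFactor α T * g α) - c T * g n|
        ≤ ε₁ * (∫ β in (n - lam)..n, montgomeryFormFactor β T) +
            |g n| * |(∫ β in (n - lam)..n, montgomeryFormFactor β T) - c T| := hatom
      _ ≤ ε₁ * (cb + 1) + |g n| * ε₂ := by gcongr
      _ ≤ η / 4 + η / 4 := add_le_add hε₁' hε₂'
      _ = η / 2 := by ring
  have hS₂ : |∫ α in (n - lam)..n, triangleWave α * g α| ≤ η / 4 :=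
    (abs_integral_triangleWave_mul_le hB hm₁ hv0 (by linarith)).trans (by
      rw [show n - (n - lam) = lam by ring]; exact hlη')
  rw [sF, sS]
  calc |(∫ α in u..(n - lam), montgomeryFormFactor α T * g α) +
          (∫ α in (n - lam)..n, montgomeryFormFactor α T * g α) -
        ((∫ α in u..(n - lam), triangleWave α * g α) +
            (∫ α in (n - lam)..n, triangleWave α * g α) + c T * g n)|
      = |((∫ α in u..(n - lam), montgomeryFormFactor α T * g α) -
            ∫ α in u..(n - lam), triangleWave α * g α) +
          (((∫ α in (n - lam)..n, montgomeryFormFactor α T * g α) - c T * g n) +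
            -(∫ α in (n - lam)..n, triangleWave α * g α))| := by ring_nf
    _ ≤ |(∫ α in u..(n - lam), montgomeryFormFactor α T * g α) -
            ∫ α in u..(n - lam), triangleWave α * g α| +
          (|(∫ α in (n - lam)..n, montgomeryFormFactor α T * g α) - c T * g n| +
            |-(∫ α in (n - lam)..n, triangleWave α * g α)|) :=
        (abs_add_le _ _).trans (add_le_add le_rfl (abs_add_le _ _))
    _ < η / 8 + (η / 2 + η / 4) := by
        rw [abs_neg]
        exact add_lt_add_of_lt_of_le h₁ (add_le_add hA₂ hS₂)
    _ ≤ η := by linarith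

/-! ### Theorem 3 to the right of `1` and to the left of `−1` -/

/-- **BGSTB 2025, Theorem 3 on `[1, v]` (the one-sided mass `δ_1^+`)** (§7: "Similarly, for `K = ±1`, the
results with the one-sided delta functions contained in `𝓕` follow immediately from Lemma 6 (iii) and (iv)"
and "the corresponding one-sided results hold when `N = 0, ±1`"). Our composition in limit form: from (W-ii)
and the right-of-`1` window input (W-one) for the level `M`, `δ` (`|∫_1^{1+λ} F(β,T) dβ − 2(P_0(T) − 1)| ≤ ε`
for all small `λ`, eventually in `T`), on `[1, v]` whose only integer point is `1`, for `g` bounded,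
a.e.-continuous within `[1,v]` and continuous at `1` from the right (implied by the printed right-Lipschitz
condition, `continuousWithinAt_Ici_of_isRightLipschitzAt`):
`∫_1^v F g − AH.calFIntegral (AH.binDensity 0 T M δ) 1 v g → 0`.
[cite: BaluyotGoldstonSuriajayaTurnageButterbaugh2025, §7 (proof of Theorem 3)] -/
theorem tendsto_sub_calFIntegral_of_right_one (hRH : RiemannHypothesis)
    (hWii : ∀ K : ℝ, ∀ ε > 0, ∃ lam0 > 0, ∀ lam : ℝ, 0 < lam → lam ≤ lam0 → ∀ᶠ T : ℝ in atTop,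
      ∀ α : ℝ, |α| ≤ K → (∀ n : ℤ, 2 * lam ≤ |α - n|) →
        |1 / (2 * lam) * (∫ β in (α - lam)..(α + lam), montgomeryFormFactor β T) - triangleWave α| ≤ ε)
    {M δ : ℝ}
    (hW1 : ∀ ε > 0, ∃ lam0 > 0, ∀ lam : ℝ, 0 < lam → lam ≤ lam0 → ∀ᶠ T : ℝ in atTop,
      |(∫ β in (1 : ℝ)..(1 + lam), montgomeryFormFactor β T) - 2 * (AH.binDensity 0 T M δ - 1)| ≤ ε)
    {v : ℝ} (hv : 1 < v) (hZ : ∀ k : ℤ, (k : ℝ) ∈ Icc (1 : ℝ) v → (k : ℝ) = 1) {g : ℝ → ℝ}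
    (hbdd : ∃ B : ℝ, ∀ x ∈ Icc (1 : ℝ) v, |g x| ≤ B)
    (hcont : ∀ᵐ x ∂(volume.restrict (Icc (1 : ℝ) v)), ContinuousWithinAt g (Icc (1 : ℝ) v) x)
    (hg : ContinuousWithinAt g (Ici 1) 1) :
    Tendsto (fun T : ℝ ↦ (∫ α in (1 : ℝ)..v, montgomeryFormFactor α T * g α) -
      AH.calFIntegral (AH.binDensity 0 T M δ) 1 v g) atTop (𝓝 0) := by
  obtain ⟨B, hB⟩ := hbdd
  obtain ⟨P, hP⟩ := exists_abs_binDensity_le hRH M δ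
  have hcb : ∃ cb : ℝ, ∀ᶠ T : ℝ in atTop, |2 * (AH.binDensity 0 T M δ - 1)| ≤ cb := by
    refine ⟨2 * (P + 1), ?_⟩
    filter_upwards [hP] with T hT
    rw [abs_mul, abs_two]
    have := abs_sub (AH.binDensity 0 T M δ) 1
    rw [abs_one] at this
    linarith
  have h := tendsto_sub_of_atom_right hWii hv hZ hB hcont hg
    (c := fun T ↦ 2 * (AH.binDensity 0 T M δ - 1)) hcb hW1
  refine h.congr fun T ↦ ?_
  rw [calFIntegral_eq_of_right_one _ hv hZ g]

/-- **BGSTB 2025, Theorem 3 on `[u, −1]` (the one-sided mass `δ_{−1}^−`)**, from (W-ii) and the SAME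
right-of-`1` window input (W-one) — `F(·,T)` is even, so `∫_{−1−λ}^{−1} F = ∫_1^{1+λ} F` (the tree's
`integral_formFactor_left_of_neg_one_eq`) — on `[u, −1]` whose only integer point is `−1`, for `g` bounded,
a.e.-continuous within `[u,−1]` and continuous at `−1` from the left (implied by the printed left-Lipschitz
condition): `∫_u^{−1} F g − AH.calFIntegral (AH.binDensity 0 T M δ) u (−1) g → 0`.
[cite: BaluyotGoldstonSuriajayaTurnageButterbaugh2025, §7 (proof of Theorem 3)] -/
theorem tendsto_sub_calFIntegral_of_left_negOne (hRH : RiemannHypothesis)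
    (hWii : ∀ K : ℝ, ∀ ε > 0, ∃ lam0 > 0, ∀ lam : ℝ, 0 < lam → lam ≤ lam0 → ∀ᶠ T : ℝ in atTop,
      ∀ α : ℝ, |α| ≤ K → (∀ n : ℤ, 2 * lam ≤ |α - n|) →
        |1 / (2 * lam) * (∫ β in (α - lam)..(α + lam), montgomeryFormFactor β T) - triangleWave α| ≤ ε)
    {M δ : ℝ}
    (hW1 : ∀ ε > 0, ∃ lam0 > 0, ∀ lam : ℝ, 0 < lam → lam ≤ lam0 → ∀ᶠ T : ℝ in atTop,
      |(∫ β in (1 : ℝ)..(1 + lam), montgomeryFormFactor β T) - 2 * (AH.binDensity 0 T M δ - 1)| ≤ ε)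
    {u : ℝ} (hu : u < -1) (hZ : ∀ k : ℤ, (k : ℝ) ∈ Icc u (-1 : ℝ) → (k : ℝ) = -1) {g : ℝ → ℝ}
    (hbdd : ∃ B : ℝ, ∀ x ∈ Icc u (-1 : ℝ), |g x| ≤ B)
    (hcont : ∀ᵐ x ∂(volume.restrict (Icc u (-1 : ℝ))), ContinuousWithinAt g (Icc u (-1 : ℝ)) x)
    (hg : ContinuousWithinAt g (Iic (-1)) (-1)) :
    Tendsto (fun T : ℝ ↦ (∫ α in u..(-1 : ℝ), montgomeryFormFactor α T * g α) -
      AH.calFIntegral (AH.binDensity 0 T M δ) u (-1) g) atTop (𝓝 0) := by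
  obtain ⟨B, hB⟩ := hbdd
  obtain ⟨P, hP⟩ := exists_abs_binDensity_le hRH M δ
  have hcb : ∃ cb : ℝ, ∀ᶠ T : ℝ in atTop, |2 * (AH.binDensity 0 T M δ - 1)| ≤ cb := by
    refine ⟨2 * (P + 1), ?_⟩
    filter_upwards [hP] with T hT
    rw [abs_mul, abs_two]
    have := abs_sub (AH.binDensity 0 T M δ) 1
    rw [abs_one] at this
    linarith
  have hW1' : ∀ ε > 0, ∃ lam0 > 0, ∀ lam : ℝ, 0 < lam → lam ≤ lam0 → ∀ᶠ T : ℝ in atTop,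
      |(∫ β in ((-1 : ℝ) - lam)..(-1 : ℝ), montgomeryFormFactor β T) -
        2 * (AH.binDensity 0 T M δ - 1)| ≤ ε := by
    intro ε hε
    obtain ⟨lam0, hlam0, h⟩ := hW1 ε hε
    refine ⟨lam0, hlam0, fun lam hlam hle ↦ ?_⟩
    filter_upwards [h lam hlam hle] with T hT
    rwa [integral_formFactor_left_of_neg_one_eq lam T]
  have h := tendsto_sub_of_atom_left hWii hu hZ hB hcont hg
    (c := fun T ↦ 2 * (AH.binDensity 0 T M δ - 1)) hcb hW1'
  refine h.congr fun T ↦ ?_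
  rw [calFIntegral_eq_of_left_negOne _ hu hZ g]


/-! ### The general interval: BGSTB 2025, Theorem 3 from the window inputs -/

/-- The degenerate interval: `∫_a^a F g − ∫_a^a 𝓕 g = 0`. [folklore] -/
private theorem calFIntegral_self (P₀ a : ℝ) (g : ℝ → ℝ) : AH.calFIntegral P₀ a a g = 0 := by
  unfold AH.calFIntegral
  have e1 : (if a < 0 ∧ 0 ≤ a then (1 : ℝ) / 2 else 0) = 0 := if_neg fun h ↦ by linarith [h.1, h.2]
  have e2 : (if a ≤ 0 ∧ 0 < a then (1 : ℝ) / 2 else 0) = 0 := if_neg fun h ↦ by linarith [h.1, h.2]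
  have e3 : (if a ≤ 1 ∧ 1 < a then (1 : ℝ) else 0) = 0 := if_neg fun h ↦ by linarith [h.1, h.2]
  have e4 : (if a < -1 ∧ -1 ≤ a then (1 : ℝ) else 0) = 0 := if_neg fun h ↦ by linarith [h.1, h.2]
  have hI : Finset.Ioo ⌊a⌋ ⌈a⌉ = ∅ := by
    refine Finset.eq_empty_iff_forall_notMem.mpr fun m hm ↦ ?_
    rw [mem_Ioo_floor_ceil] at hm
    linarith [hm.1, hm.2]
  rw [e1, e2, e3, e4, hI, intervalIntegral.integral_same]
  simp

/-- **BGSTB 2025, Theorem 3 — the composition from the window inputs** ("Now for a general interval `[a,b]`,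
`a,b ∉ ℤ`, we have writing `[a] = N−1`, `[b] = M`, and taking `λ < min(‖a‖,‖b‖)`,
`∫_a^b F g = ∫_a^{N−λ} Fg + ∑_{N≤j≤M} ∫_{j−λ}^{j+λ} Fg + ∑_{N≤j≤M−1} ∫_{j+λ}^{j+1−λ} Fg + ∫_{M+λ}^b Fg
∼ ∫_a^b 𝓕(α) g(α) dα`, since each integral in the middle step has been evaluated above to give the
right-hand side. If `a` or `b` are equal to `0` or `±1` we use the one-sided delta functions to obtain the same
result."). OURS: the conclusion of the typed claim `bgstb2025_theorem3` (`AlternativeHypothesisFormFactor.lean`)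
VERBATIM — every admissible `[a,b]`, every `g` "Riemann integrable" with the printed pointwise Lipschitz
conditions, the `∀ δ → ∀ᶠ M → Tendsto_T` rendering with `P_0(T) = AH.binDensity 0 T M δ` — derived from RH and
the WINDOW INPUTS in `M`-free limit form along `T → ∞`: (W-ii) integer-free windows → `s(α)`; (W-even) windows
at the even `2L ≠ 0` → mass `1`; (W-odd) windows at the odd `K`, `|K| ≥ 3` → mass `2(P_0(T)−1)`, for every bin
half-width `0 < δ ≤ 1/2` and level `M ≥ δ/2`; (W-one) the right half-window at `1` → mass `2(P_0(T)−1)`. These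
inputs are what "taking `T → ∞` and then making `M` large and `λ` appropriately small in Lemma 6" extracts from
Lemma 6 (i)–(iv) under AH-Pairs with `M`-uniform constants; that extraction is NOT done here, so this is a
theorem about the composition only (nothing is asserted about RH or AH-Pairs). Proof: strong induction on the
number of half-integers inside `(a,b)`, cutting at them (`tendsto_sub_calFIntegral_add`); a piece inside some
`[m−½, m+½]` is integer-free (`tendsto_sub_calFIntegral_of_intFree`), inside `[−1,1]` (the tree's
`bgstb2025_theorem3_of_subset_Icc`, RH alone), an even/odd atom (`tendsto_sub_calFIntegral_of_even/_of_odd`),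
or is cut once more at `±1` (`tendsto_sub_calFIntegral_of_right_one/_of_left_negOne`).
[cite: BaluyotGoldstonSuriajayaTurnageButterbaugh2025, Theorem 3 and §7 (proof of Theorem 3)] -/
theorem _root_.Literature.NumberTheory.LFunctions.bgstb2025_theorem3_of_inputs (hRH : RiemannHypothesis)
    (hWii : ∀ K : ℝ, ∀ ε > 0, ∃ lam0 > 0, ∀ lam : ℝ, 0 < lam → lam ≤ lam0 → ∀ᶠ T : ℝ in atTop,
      ∀ α : ℝ, |α| ≤ K → (∀ n : ℤ, 2 * lam ≤ |α - n|) →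
        |1 / (2 * lam) * (∫ β in (α - lam)..(α + lam), montgomeryFormFactor β T) - triangleWave α| ≤ ε)
    (hWe : ∀ L : ℤ, L ≠ 0 → ∀ ε > 0, ∃ lam0 > 0, ∀ lam : ℝ, 0 < lam → lam ≤ lam0 → ∀ᶠ T : ℝ in atTop,
      |(∫ β in (2 * (L : ℝ) - lam)..(2 * (L : ℝ) + lam), montgomeryFormFactor β T) - 1| ≤ ε)
    (hWo : ∀ K : ℤ, Odd K → 3 ≤ |K| → ∀ δ : ℝ, 0 < δ → δ ≤ 1 / 2 → ∀ M : ℝ, δ / 2 ≤ M →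
      ∀ ε > 0, ∃ lam0 > 0, ∀ lam : ℝ, 0 < lam → lam ≤ lam0 → ∀ᶠ T : ℝ in atTop,
        |(∫ β in ((K : ℝ) - lam)..((K : ℝ) + lam), montgomeryFormFactor β T) -
          2 * (AH.binDensity 0 T M δ - 1)| ≤ ε)
    (hW1 : ∀ δ : ℝ, 0 < δ → δ ≤ 1 / 2 → ∀ M : ℝ, δ / 2 ≤ M →
      ∀ ε > 0, ∃ lam0 > 0, ∀ lam : ℝ, 0 < lam → lam ≤ lam0 → ∀ᶠ T : ℝ in atTop,
        |(∫ β in (1 : ℝ)..(1 + lam), montgomeryFormFactor β T) - 2 * (AH.binDensity 0 T M δ - 1)| ≤ ε) :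
    ∀ (a b : ℝ) (g : ℝ → ℝ), a ≤ b →
      (∀ m : ℤ, m ≠ -1 → m ≠ 0 → m ≠ 1 → (a ≠ m ∧ b ≠ m)) →
      (∃ B : ℝ, ∀ x ∈ Icc a b, |g x| ≤ B) →
      (∀ᵐ x ∂(volume.restrict (Icc a b)), ContinuousWithinAt g (Icc a b) x) →
      (∀ m : ℤ, m ≠ -1 → m ≠ 1 → IsLipschitzAt g m) →
      IsRightLipschitzAt g 1 → IsLeftLipschitzAt g (-1) →
        ∀ δ : ℝ, 0 < δ → δ ≤ 1 / 2 → ∀ᶠ M : ℝ in atTop,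
          Tendsto (fun T : ℝ ↦ (∫ α in a..b, montgomeryFormFactor α T * g α) -
            AH.calFIntegral (AH.binDensity 0 T M δ) a b g) atTop (𝓝 0) := by
  intro a b g hab hadm hbdd hcont hLip hR hL δ hδ hδ2
  filter_upwards [eventually_ge_atTop (δ / 2)] with M hM
  obtain ⟨B, hB⟩ := hbdd
  have hgm : AEStronglyMeasurable g (volume.restrict (Icc a b)) :=
    AH.aestronglyMeasurable_of_ae_continuousWithinAt hcont
  have hLip0 : IsLipschitzAt g 0 := by simpa using hLip 0 (by norm_num) (by norm_num)
  -- data inherited by sub-intervals of `[a, b]`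
  have hBsub : ∀ {x y : ℝ}, x ∈ Icc a b → y ∈ Icc a b → ∃ B' : ℝ, ∀ t ∈ Icc x y, |g t| ≤ B' :=
    fun hx hy ↦ ⟨B, fun t ht ↦ hB t ⟨hx.1.trans ht.1, ht.2.trans hy.2⟩⟩
  -- BASE: an admissible piece inside some `[m₀ − ½, m₀ + ½]`
  have base : ∀ x y : ℝ, x ∈ Icc a b → y ∈ Icc a b → x ≤ y →
      (∀ m : ℤ, m ≠ -1 → m ≠ 0 → m ≠ 1 → (x ≠ m ∧ y ≠ m)) →
      ∀ m₀ : ℤ, (m₀ : ℝ) - 1 / 2 ≤ x → y ≤ (m₀ : ℝ) + 1 / 2 →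
      Tendsto (fun T : ℝ ↦ (∫ α in x..y, montgomeryFormFactor α T * g α) -
        AH.calFIntegral (AH.binDensity 0 T M δ) x y g) atTop (𝓝 0) := by
    intro x y hx hy hxy hadm' m₀ h1 h2
    have hcont' := ae_continuousWithinAt_mono hcont hx hy
    -- the integers of `[x, y]` are `m₀`
    have hZ : ∀ k : ℤ, (k : ℝ) ∈ Icc x y → (k : ℝ) = m₀ := by
      intro k hk
      have hk1 : m₀ - 1 < k := by exact_mod_cast (show (m₀ : ℝ) - 1 < k by linarith [hk.1])
      have hk2 : k < m₀ + 1 := by exact_mod_cast (show (k : ℝ) < m₀ + 1 by linarith [hk.2])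
      have : k = m₀ := by omega
      exact_mod_cast this
    by_cases hin : x ≤ (m₀ : ℝ) ∧ (m₀ : ℝ) ≤ y
    swap
    · -- no integer in `[x, y]`
      have hZ' : ∀ k : ℤ, (k : ℝ) ∉ Icc x y := fun k hk ↦ by
        have e := hZ k hk
        rw [e] at hk
        exact hin ⟨hk.1, hk.2⟩
      exact tendsto_sub_calFIntegral_of_intFree hWii hxy hZ' (hBsub hx hy) hcont'
        (fun T ↦ AH.binDensity 0 T M δ)
    obtain ⟨hxm, hmy⟩ := hin
    -- `m₀ ∈ [x, y]`: which integer is it?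
    by_cases h0 : m₀ = 0
    · -- inside `[−1, 1]`: Montgomery's theorem alone
      subst h0
      push_cast at h1 h2
      exact bgstb2025_theorem3_of_subset_Icc hRH hxy (by linarith) (by linarith) (hBsub hx hy) hcont' hLip0
        (fun T ↦ AH.binDensity 0 T M δ)
    by_cases h1' : m₀ = 1
    · subst h1'
      push_cast at h1 h2 hZ hxm hmy
      by_cases hy1 : y ≤ 1
      · exact bgstb2025_theorem3_of_subset_Icc hRH hxy (by linarith) hy1 (hBsub hx hy) hcont' hLip0
          (fun T ↦ AH.binDensity 0 T M δ)
      push Not at hy1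
      have h1I : (1 : ℝ) ∈ Icc a b := ⟨hx.1.trans hxm, hmy.trans hy.2⟩
      have hZr : ∀ k : ℤ, (k : ℝ) ∈ Icc (1 : ℝ) y → (k : ℝ) = 1 := fun k hk ↦ hZ k ⟨hxm.trans hk.1, hk.2⟩
      have hright := tendsto_sub_calFIntegral_of_right_one hRH hWii (hW1 δ hδ hδ2 M hM) hy1 hZr
        (hBsub h1I hy) (ae_continuousWithinAt_mono hcont h1I hy) (continuousWithinAt_Ici_of_isRightLipschitzAt hR)
      rcases hxm.eq_or_lt with hx1 | hx1
      · rw [hx1]; exact hright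
      · have hleft := bgstb2025_theorem3_of_subset_Icc hRH hxm (by linarith) le_rfl (hBsub hx h1I)
          (ae_continuousWithinAt_mono hcont hx h1I) hLip0 (fun T ↦ AH.binDensity 0 T M δ)
        exact tendsto_sub_calFIntegral_add hxm hmy (fun m _ _ hm1 ↦ by exact_mod_cast hm1.symm)
          (Eventually.of_forall fun T ↦ intervalIntegrable_formFactor_mul hB hgm hx h1I T)
          (Eventually.of_forall fun T ↦ intervalIntegrable_formFactor_mul hB hgm h1I hy T)
          (intervalIntegrable_triangleWave_mul hB hgm hx h1I) (intervalIntegrable_triangleWave_mul hB hgm h1I hy)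
          hleft hright
    by_cases hm1' : m₀ = -1
    · subst hm1'
      push_cast at h1 h2 hZ hxm hmy
      by_cases hx1 : -1 ≤ x
      · exact bgstb2025_theorem3_of_subset_Icc hRH hxy hx1 (by linarith) (hBsub hx hy) hcont' hLip0
          (fun T ↦ AH.binDensity 0 T M δ)
      push Not at hx1
      have h1I : (-1 : ℝ) ∈ Icc a b := ⟨hx.1.trans hxm, hmy.trans hy.2⟩
      have hZl : ∀ k : ℤ, (k : ℝ) ∈ Icc x (-1 : ℝ) → (k : ℝ) = -1 := fun k hk ↦ hZ k ⟨hk.1, hk.2.trans hmy⟩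
      have hleft := tendsto_sub_calFIntegral_of_left_negOne hRH hWii (hW1 δ hδ hδ2 M hM) hx1 hZl
        (hBsub hx h1I) (ae_continuousWithinAt_mono hcont hx h1I) (continuousWithinAt_Iic_of_isLeftLipschitzAt hL)
      rcases hmy.eq_or_lt with hy1 | hy1
      · rw [← hy1]; exact hleft
      · have hright := bgstb2025_theorem3_of_subset_Icc hRH hmy le_rfl (by linarith) (hBsub h1I hy)
          (ae_continuousWithinAt_mono hcont h1I hy) hLip0 (fun T ↦ AH.binDensity 0 T M δ)
        exact tendsto_sub_calFIntegral_add hxm hmy (fun m hm1 _ _ ↦ by exact_mod_cast hm1.symm)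
          (Eventually.of_forall fun T ↦ intervalIntegrable_formFactor_mul hB hgm hx h1I T)
          (Eventually.of_forall fun T ↦ intervalIntegrable_formFactor_mul hB hgm h1I hy T)
          (intervalIntegrable_triangleWave_mul hB hgm hx h1I) (intervalIntegrable_triangleWave_mul hB hgm h1I hy)
          hleft hright
    -- `|m₀| ≥ 2`: an interior atom
    obtain ⟨hxne, hyne⟩ := hadm' m₀ hm1' h0 h1'
    have hun : x < (m₀ : ℝ) := lt_of_le_of_ne hxm hxne
    have hnv : (m₀ : ℝ) < y := lt_of_le_of_ne hmy (Ne.symm hyne)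
    have hgc : ContinuousAt g (m₀ : ℝ) := continuousAt_of_isLipschitzAt (hLip m₀ hm1' h1')
    rcases Int.even_or_odd m₀ with hev | hodd
    · obtain ⟨L, hLL⟩ := hev
      have hL0 : L ≠ 0 := by rintro rfl; simp at hLL; exact h0 hLL
      have hmL : (m₀ : ℝ) = 2 * (L : ℝ) := by rw [hLL]; push_cast; ring
      rw [hmL] at hun hnv hgc
      have hZ' : ∀ k : ℤ, (k : ℝ) ∈ Icc x y → (k : ℝ) = 2 * (L : ℝ) := fun k hk ↦ (hZ k hk).trans hmL
      exact tendsto_sub_calFIntegral_of_even hWii hL0 (hWe L hL0) hun hnv hZ' (hBsub hx hy) hcont' hgc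
        (fun T ↦ AH.binDensity 0 T M δ)
    · have h3 : 3 ≤ |m₀| := by
        obtain ⟨r, hr⟩ := hodd
        rw [le_abs]
        omega
      exact tendsto_sub_calFIntegral_of_odd hRH hWii hodd h3 (hWo m₀ hodd h3 δ hδ hδ2 M hM) hun hnv hZ
        (hBsub hx hy) hcont' hgc
  -- INDUCTION on the number of half-integers inside `(x, y)`
  suffices key : ∀ N : ℕ, ∀ x y : ℝ, x ∈ Icc a b → y ∈ Icc a b → x ≤ y →
      (∀ m : ℤ, m ≠ -1 → m ≠ 0 → m ≠ 1 → (x ≠ m ∧ y ≠ m)) →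
      (Finset.Ioo ⌊x - 1 / 2⌋ ⌈y - 1 / 2⌉).card ≤ N →
      Tendsto (fun T : ℝ ↦ (∫ α in x..y, montgomeryFormFactor α T * g α) -
        AH.calFIntegral (AH.binDensity 0 T M δ) x y g) atTop (𝓝 0) from
    key _ a b (left_mem_Icc.2 hab) (right_mem_Icc.2 hab) hab hadm le_rfl
  intro N
  induction N with
  | zero =>
    intro x y hx hy hxy hadm' hcard
    have hempty : Finset.Ioo ⌊x - 1 / 2⌋ ⌈y - 1 / 2⌉ = ∅ := Finset.card_eq_zero.mp (Nat.le_zero.mp hcard)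
    have hno : ∀ m : ℤ, ¬((x : ℝ) < m + 1 / 2 ∧ (m : ℝ) + 1 / 2 < y) := by
      intro m hm
      have : m ∈ Finset.Ioo ⌊x - 1 / 2⌋ ⌈y - 1 / 2⌉ := by
        rw [Finset.mem_Ioo, Int.floor_lt, Int.lt_ceil]
        constructor <;> linarith [hm.1, hm.2]
      rw [hempty] at this
      simp at this
    set m₀ : ℤ := ⌊x + 1 / 2⌋ with hm₀
    have h1 : (m₀ : ℝ) - 1 / 2 ≤ x := by have := Int.floor_le (x + 1 / 2); linarith
    have h2 : y ≤ (m₀ : ℝ) + 1 / 2 := by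
      by_contra h
      push Not at h
      exact hno m₀ ⟨by have := Int.lt_floor_add_one (x + 1 / 2); linarith, h⟩
    exact base x y hx hy hxy hadm' m₀ h1 h2
  | succ N ih =>
    intro x y hx hy hxy hadm' hcard
    by_cases hc : (Finset.Ioo ⌊x - 1 / 2⌋ ⌈y - 1 / 2⌉).card ≤ N
    · exact ih x y hx hy hxy hadm' hc
    push Not at hc
    obtain ⟨m, hmmem⟩ : (Finset.Ioo ⌊x - 1 / 2⌋ ⌈y - 1 / 2⌉).Nonempty := Finset.card_pos.mp (by omega)
    have hm : x - 1 / 2 < m ∧ (m : ℝ) < y - 1 / 2 := by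
      rw [Finset.mem_Ioo, Int.floor_lt, Int.lt_ceil] at hmmem; exact hmmem
    -- cut at the half-integer `c = m + ½`
    set c : ℝ := (m : ℝ) + 1 / 2 with hc_def
    have hxc : x ≤ c := by linarith [hm.1]
    have hcy : c ≤ y := by linarith [hm.2]
    have hcI : c ∈ Icc a b := ⟨hx.1.trans hxc, hcy.trans hy.2⟩
    have hcZ : ∀ k : ℤ, c ≠ (k : ℝ) := by
      intro k hk
      have : (2 * m + 1 : ℤ) = 2 * k := by
        exact_mod_cast (show (2 * m + 1 : ℝ) = 2 * k by rw [hc_def] at hk; linarith)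
      omega
    have hadm₁ : ∀ k : ℤ, k ≠ -1 → k ≠ 0 → k ≠ 1 → (x ≠ k ∧ c ≠ k) :=
      fun k hk1 hk2 hk3 ↦ ⟨(hadm' k hk1 hk2 hk3).1, hcZ k⟩
    have hadm₂ : ∀ k : ℤ, k ≠ -1 → k ≠ 0 → k ≠ 1 → (c ≠ k ∧ y ≠ k) :=
      fun k hk1 hk2 hk3 ↦ ⟨hcZ k, (hadm' k hk1 hk2 hk3).2⟩
    have hcm : c - 1 / 2 = (m : ℝ) := by rw [hc_def]; ring
    have hcard₁ : (Finset.Ioo ⌊x - 1 / 2⌋ ⌈c - 1 / 2⌉).card ≤ N := by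
      have hsub : Finset.Ioo ⌊x - 1 / 2⌋ ⌈c - 1 / 2⌉ ⊆ (Finset.Ioo ⌊x - 1 / 2⌋ ⌈y - 1 / 2⌉).erase m := by
        intro k hk
        rw [Finset.mem_erase, Finset.mem_Ioo, Int.floor_lt, Int.lt_ceil]
        rw [Finset.mem_Ioo, Int.floor_lt, Int.lt_ceil, hcm] at hk
        have hk2 : k < m := by exact_mod_cast hk.2
        refine ⟨by omega, hk.1, ?_⟩
        have : (k : ℝ) < m := by exact_mod_cast hk2
        linarith [hm.2]
      calc (Finset.Ioo ⌊x - 1 / 2⌋ ⌈c - 1 / 2⌉).card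
          ≤ ((Finset.Ioo ⌊x - 1 / 2⌋ ⌈y - 1 / 2⌉).erase m).card := Finset.card_le_card hsub
        _ = (Finset.Ioo ⌊x - 1 / 2⌋ ⌈y - 1 / 2⌉).card - 1 := Finset.card_erase_of_mem hmmem
        _ ≤ N := by omega
    have hcard₂ : (Finset.Ioo ⌊c - 1 / 2⌋ ⌈y - 1 / 2⌉).card ≤ N := by
      have hsub : Finset.Ioo ⌊c - 1 / 2⌋ ⌈y - 1 / 2⌉ ⊆ (Finset.Ioo ⌊x - 1 / 2⌋ ⌈y - 1 / 2⌉).erase m := by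
        intro k hk
        rw [Finset.mem_erase, Finset.mem_Ioo, Int.floor_lt, Int.lt_ceil]
        rw [Finset.mem_Ioo, Int.floor_lt, Int.lt_ceil, hcm] at hk
        have hk1 : m < k := by exact_mod_cast hk.1
        refine ⟨by omega, ?_, hk.2⟩
        have : (m : ℝ) < k := by exact_mod_cast hk1
        linarith [hm.1]
      calc (Finset.Ioo ⌊c - 1 / 2⌋ ⌈y - 1 / 2⌉).card
          ≤ ((Finset.Ioo ⌊x - 1 / 2⌋ ⌈y - 1 / 2⌉).erase m).card := Finset.card_le_card hsub
        _ = (Finset.Ioo ⌊x - 1 / 2⌋ ⌈y - 1 / 2⌉).card - 1 := Finset.card_erase_of_mem hmmem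
        _ ≤ N := by omega
    have h₁ := ih x c hx hcI hxc hadm₁ hcard₁
    have h₂ := ih c y hcI hy hcy hadm₂ hcard₂
    exact tendsto_sub_calFIntegral_add hxc hcy (fun k _ _ _ ↦ hcZ k)
      (Eventually.of_forall fun T ↦ intervalIntegrable_formFactor_mul hB hgm hx hcI T)
      (Eventually.of_forall fun T ↦ intervalIntegrable_formFactor_mul hB hgm hcI hy T)
      (intervalIntegrable_triangleWave_mul hB hgm hx hcI) (intervalIntegrable_triangleWave_mul hB hgm hcI hy)
      h₁ h₂


/-- **The typed claim `bgstb2025_theorem3` modulo the window inputs**: if RH and AH-Pairs yield the four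
limit-form window statements (W-ii), (W-even), (W-odd), (W-one) — the content of BGSTB 2025, Lemma 6 (i)–(iv)
"taking `T → ∞` and then making `M` large and `λ` appropriately small", with `M`-uniform constants (cell row «U»;
not proved here) — then `bgstb2025_theorem3` holds as typed. This is the one-line assembler awaiting those inputs;
nothing is asserted about RH or AH-Pairs. [cite: BaluyotGoldstonSuriajayaTurnageButterbaugh2025, Theorem 3 and §7 (proof of Theorem 3)] -/
theorem _root_.Literature.NumberTheory.LFunctions.bgstb2025_theorem3_of_windows
    (H : RiemannHypothesis → AHPairs →
      (∀ K : ℝ, ∀ ε > 0, ∃ lam0 > 0, ∀ lam : ℝ, 0 < lam → lam ≤ lam0 → ∀ᶠ T : ℝ in atTop,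
        ∀ α : ℝ, |α| ≤ K → (∀ n : ℤ, 2 * lam ≤ |α - n|) →
          |1 / (2 * lam) * (∫ β in (α - lam)..(α + lam), montgomeryFormFactor β T) - triangleWave α| ≤ ε) ∧
      (∀ L : ℤ, L ≠ 0 → ∀ ε > 0, ∃ lam0 > 0, ∀ lam : ℝ, 0 < lam → lam ≤ lam0 → ∀ᶠ T : ℝ in atTop,
        |(∫ β in (2 * (L : ℝ) - lam)..(2 * (L : ℝ) + lam), montgomeryFormFactor β T) - 1| ≤ ε) ∧
      (∀ K : ℤ, Odd K → 3 ≤ |K| → ∀ δ : ℝ, 0 < δ → δ ≤ 1 / 2 → ∀ M : ℝ, δ / 2 ≤ M →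
        ∀ ε > 0, ∃ lam0 > 0, ∀ lam : ℝ, 0 < lam → lam ≤ lam0 → ∀ᶠ T : ℝ in atTop,
          |(∫ β in ((K : ℝ) - lam)..((K : ℝ) + lam), montgomeryFormFactor β T) -
            2 * (AH.binDensity 0 T M δ - 1)| ≤ ε) ∧
      (∀ δ : ℝ, 0 < δ → δ ≤ 1 / 2 → ∀ M : ℝ, δ / 2 ≤ M →
        ∀ ε > 0, ∃ lam0 > 0, ∀ lam : ℝ, 0 < lam → lam ≤ lam0 → ∀ᶠ T : ℝ in atTop,
          |(∫ β in (1 : ℝ)..(1 + lam), montgomeryFormFactor β T) - 2 * (AH.binDensity 0 T M δ - 1)| ≤ ε)) :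
    bgstb2025_theorem3 := by
  intro hRH hAH
  obtain ⟨hWii, hWe, hWo, hW1⟩ := H hRH hAH
  exact bgstb2025_theorem3_of_inputs hRH hWii hWe hWo hW1

end Literature.NumberTheory.LFunctions.AH.Thm3

end
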